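import Mathlib
import Literature.Analysis.FluidPDE.PineauVicolAngularMean
import Literature.Analysis.FluidPDE.Wei2016HardyCutoff
import Literature.Analysis.FluidPDE.SteadyNSLiouvilleLpDirichlet
import Literature.Analysis.FluidPDE.SteadyHelicalLiouville
import Literature.Analysis.FluidPDE.PlanarCircleWirtinger
import Literature.Analysis.FluidPDE.CylindricalCutoff
import Literature.Analysis.FluidPDE.HomogeneousEulerProofs
import Literature.Analysis.FluidPDE.SteadyNSLocalEnergy
import Literature.Analysis.FluidPDE.KNSSLineInvariantLiouville
import Literature.Analysis.FluidPDE.GigaMiura2011ScaledAlignmentBlowupLimitHolds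
import Literature.Analysis.FluidPDE.SteadyNSBoundedAnalytic
import Literature.Analysis.FluidPDE.SteadyHelicalLiouvilleHolds
import HarnessLib

/-!
# Steady Navier–Stokes Liouville theorems in the periodic slab, file 3 of 4: mean-free radial velocity, the axisymmetric-swirl and axisymmetric-radial cases (Thm 1.4 (a), (b)), the stream potential and the cut-off coefficient of case (c) (re-homed proofs)

**Two Liouville theorems for bounded smooth steady Navier–Stokes flows on `ℝ³` that are periodic in the axial variable.**
(1) Q. Han, Y. Wang, C. Xie, *Liouville-type theorems for steady Navier–Stokes system under helical symmetry or Navier boundary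
conditions*, arXiv:2312.10382 = Sci. China Math. (2025), Theorem 1.1 [HanWangXie2023]: for every viscosity `ν > 0` and pitch
`κ ≠ 0`, a bounded smooth helically symmetric steady solution on `ℝ³` is an axial constant `C e₃` — the named fact
`Literature.Analysis.FluidPDE.HanWangXie2023_helical_liouville` (`SteadyHelicalLiouville.lean`).  (2) J. Bang, C. Gui, Y. Wang,
C. Xie, *Liouville-type theorems for steady solutions to the Navier–Stokes system in a slab*, arXiv:2205.13259 = J. Fluid Mech.
1005 (2025) A6, Theorem 1.4 [BangGuiWangXie2025]: a bounded smooth steady solution on `ℝ³`, `L`-periodic in `x₃`, is an axial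
constant as soon as (a) its swirl velocity is axisymmetric, or (b) its radial velocity is axisymmetric, or (c) `r u^r → 0`
uniformly as `r → ∞`; and (d) it is constant when `sup ‖U‖ < 2πν/L` — the named fact
`Literature.Analysis.FluidPDE.BangGuiWangXie2025_periodicSlab_liouville` (`PeriodicSlabSteadyLiouville.lean`).  Both facts are
PROVED in the tree by the Navier–Stokes blow-up-scenario census cell (`pub/ns-census`, rows S6/S7: periodic pressure, the
Poincaré–Wirtinger inequality on vertical periods, the helical / axisymmetric zero-flux of the radial velocity, foot-point
splitting of the pressure, a stream-function corrector in case (c), weighted dyadic energy (Saint-Venant) estimates) — until now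
Summits-side only (`Summits/NavierStokesRegularity/NavierStokesRegularity/Theorems/ScenarioCensusSteadyS6.lean`, `…S7.lean`).
RE-HOMED into `Literature/` by the Hodge foundations lane (`lit-hodgefound`, prover p20, generation 39) as FOUR files: verbatim
DECLARATION-LEVEL ports (the 135 declarations the two discharges need, in dependency order; each Part header lists the
declarations of its source module that are NOT carried) of 29 Summits modules
`Summits/NavierStokesRegularity/NavierStokesRegularity/Theorems/ScenarioCensus{PeriodicSlab,HelicalSlab}*.lean`, namespaces
`Summit.NavierStokesRegularity.NavierStokesRegularity.Theorems.ScenarioCensus{,.PeriodicSlab,.HelicalSlab}` re-rooted to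
`Literature.Analysis.SteadySlabLiouville{,.PeriodicSlab,.HelicalSlab}` (a root outside `Literature.Analysis.FluidPDE` on purpose:
namespace-prefix resolution would otherwise shadow the cone's lemmas by same-named `FluidPDE` lemmas); imports from `Literature/`
and Mathlib only; no `sorry`, no new axiom, NO named fact (D-0026); the census-row aliases `Row_S6`, `Row_S7`, `Row_S7c` and
`row_S*_excluded` of `ScenarioCensusSteady{,S6,S7}.lean` are Summits bookkeeping and are not carried.  PROVENANCE CONVENTION:
docstrings are carried byte-for-byte; declarations the cell cites keep their cites; `[folklore]`-tagged and untagged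
declarations (the cell's own lemmas) carry the Part's tag `[cite: <Key>, <loc> (source of the ARGUMENT this module implements;
this declaration is the cell's own lemma or plumbing, NOT a printed statement)]`, because the gate does not admit a public
Literature theorem without a cite tag.

THIS FILE (3 of 4) ports: ScenarioCensusPeriodicSlabMeanFree, ScenarioCensusPeriodicSlabSwirlFlux, ScenarioCensusPeriodicSlabSwirlLiouville, ScenarioCensusPeriodicSlabRadialFlux, ScenarioCensusPeriodicSlabRadialLiouville, ScenarioCensusPeriodicSlabStream, ScenarioCensusPeriodicSlabStreamCorrector, ScenarioCensusPeriodicSlabCutoffCoeff.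
-/

noncomputable section

/-!
## Part 1 — port of `Summits/NavierStokesRegularity/NavierStokesRegularity/Theorems/ScenarioCensusPeriodicSlabMeanFree.lean` (2 declarations kept)

# Census rows S6 / S7: bounded periodic steady flows with mean-free radial velocity are constant

Support file for the scenario census of `NavierStokesRegularity` (cell `pub/ns-census`, block S).
The proof of row S6 (`HelicalSlab.helical_liouville`, Han–Wang–Xie 2023 Thm 1.1) uses the helical
symmetry only through (i) axial periodicity, (ii) the vanishing of the vertical period means of
the radial velocity `⟪x_h, U⟫` (HWX (A117)), (iii) "a helically symmetric constant is axial". This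
file isolates the symmetry-free core, which is also the common core of Bang–Gui–Wang–Xie 2025,
Thm 1.4 (a) (`u^θ` independent of `θ`) and (b) (`u^r` independent of `θ`) — row S7 of the census —
whose printed proofs (arXiv:2205.13259, §6 Steps 1–2) start from the same identity
`∫₀¹ r u^r dz = 0`:

* `periodicSlab_liouville_of_radial_verticalMean` — for `ν > 0`, `L > 0`: a smooth steady
  Navier–Stokes flow `(U, P)` on `ℝ³` (`IsLerayProfile ν 0 U P`, `U, P ∈ C^∞`), bounded, axially
  `L`-periodic, with `∫₀ᴸ ⟪x_h, U(x + s e₃)⟫ ds = 0` for every `x`, is a constant vector.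

No summit statement and no census row is proved in this file.

## References

* J. Han, Y. Wang, C. Xie, arXiv:2312.10382 (2023), §3. [HanWangXie2023]
* J. Bang, C. Gui, Y. Wang, C. Xie, J. Fluid Mech. 1005 (2025) A6 = arXiv:2205.13259, Thm 1.4,
  §6 Steps 1–2. [BangGuiWangXie2025]
-/

section Part1

open _root_.MeasureTheory _root_.Set _root_.Function _root_.Filter _root_.InnerProductSpace
open scoped _root_.Topology _root_.ENNReal _root_.NNReal RealInnerProductSpace Laplacian _root_.ContDiff

namespace Literature.Analysis.SteadySlabLiouville.PeriodicSlab

open Literature.Analysis Literature.Analysis.FluidPDE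
open Literature.Analysis.SteadySlabLiouville.HelicalSlab

/-- **Bounded periodic steady flows with mean-free radial velocity are constant (unit
viscosity).** Let `(U, P)` be a smooth steady solution at `ν = 1` (`IsLerayProfile 1 0 U P`,
`U, P ∈ C^∞`) on `ℝ³`, bounded and axially `L`-periodic (`L > 0`), with
`∫₀ᴸ ⟪x_h, U(x + s e₃)⟫ ds = 0` for every `x`. Then `U` is a constant vector.
[cite: HanWangXie2023, Thm 1.1, proof §3; BangGuiWangXie2025, Thm 1.4 (d), proof §5 (source of the ARGUMENT this module implements; this declaration is the cell’s own lemma or plumbing, NOT a printed statement)] -/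
theorem periodicSlab_liouville_of_radial_verticalMean_one {L : ℝ} (hL : 0 < L)
    {U : EuclideanSpace ℝ (Fin 3) → EuclideanSpace ℝ (Fin 3)} {P : EuclideanSpace ℝ (Fin 3) → ℝ}
    (hprof : IsLerayProfile 1 0 U P) (hU : ContDiff ℝ (⊤ : ℕ∞) U) (hP : ContDiff ℝ (⊤ : ℕ∞) P)
    (hbd : ∃ M : ℝ, ∀ x, ‖U x‖ ≤ M) (hper : IsAxiallyPeriodic L U)
    (hmean : ∀ x, ∫ s in (0 : ℝ)..L, ⟪horizPart x, U (x + s • eZ)⟫ = 0) :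
    ∃ C : EuclideanSpace ℝ (Fin 3), U = fun _ => C := by
  obtain ⟨M, hM⟩ := hbd
  have hst : IsSteadyClassicalNS 1 0 U P := isSteadyClassicalNS_of_isLerayProfile hprof hU hP
  -- periodic pressure, derivative bounds
  have hPper : IsAxiallyPeriodic L P := steady_pressure_periodic hL hst hM hper
  obtain ⟨K₁, K₂, K₃, -, -, -, hK⟩ := steady_derivative_bounds one_pos hst hM
  have hK₁ : ∀ x, ‖fderiv ℝ U x‖ ≤ K₁ := fun x => (hK x).1
  have hK₃ : ∀ x, ‖fderiv ℝ P x‖ ≤ K₃ := fun x => by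
    have e : ‖fderiv ℝ P x‖ = ‖gradient P x‖ := by
      rw [gradient]; exact ((InnerProductSpace.toDual ℝ (EuclideanSpace ℝ (Fin 3))).symm.norm_map _).symm
    rw [e]; exact (hK x).2.2
  have hU1 : ContDiff ℝ 1 U := contDiff_infty.1 hU 1
  have hUd : Differentiable ℝ U := hU1.differentiable one_ne_zero
  -- the period energies
  set F : EuclideanSpace ℝ (Fin 3) → ℝ := fun x => frobeniusNormSq (fderiv ℝ U x) with hF
  set E : ℝ → ℝ := fun r => ∫ x in zSlab L 0 ∩ {x | cylRadius x < r}, F x with hE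
  have hFc : Continuous F := continuous_frobeniusNormSq_fderiv hU1 one_ne_zero
  have hF0 : ∀ x, 0 ≤ F x := fun x => frobeniusNormSq_nonneg _
  set b := EuclideanSpace.basisFun (Fin 3) ℝ with hb
  have hFB' : ∀ x, F x ≤ 3 * K₁ ^ 2 := fun x => by
    show frobeniusNormSq (fderiv ℝ U x) ≤ 3 * K₁ ^ 2
    rw [frobeniusNormSq_eq_sum b]
    calc ∑ i, ‖fderiv ℝ U x (b i)‖ ^ 2 ≤ ∑ _i : Fin 3, K₁ ^ 2 := Finset.sum_le_sum fun i _ => by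
          have h1 : ‖fderiv ℝ U x (b i)‖ ≤ K₁ := by
            calc ‖fderiv ℝ U x (b i)‖ ≤ ‖fderiv ℝ U x‖ * ‖b i‖ := ContinuousLinearMap.le_opNorm _ _
              _ ≤ K₁ := by rw [b.orthonormal.1 i, mul_one]; exact hK₁ x
          exact pow_le_pow_left₀ (norm_nonneg _) h1 2
      _ = 3 * K₁ ^ 2 := by simp
  have hFB : ∀ x, ‖F x‖ ≤ 3 * K₁ ^ 2 := fun x => by
    rw [Real.norm_of_nonneg (hF0 x)]; exact hFB' x
  obtain ⟨a, c, ha, hc, hineq⟩ := helical_energy_dyadic_estimate hL hprof hU hP hper hPper hM hFB'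
    hK₃ hmean E (fun r => rfl)
  have hFper : IsAxiallyPeriodic L F := fun x => by
    simp only [hF, isAxiallyPeriodic_fderiv hper x]
  have hEint : ∀ r, 0 < r → IntegrableOn F (zSlab L 0 ∩ {x | cylRadius x < r}) volume :=
    fun r hr => integrableOn_zSlab_inter_cyl_of_bound hL hr hFc hFB
  have hmono : ∀ r s, 1 ≤ r → r ≤ s → E r ≤ E s := fun r s hr hrs =>
    setIntegral_mono_set (hEint s (by linarith)) (Eventually.of_forall fun x => hF0 x)
      (Eventually.of_forall fun x hx => ⟨hx.1, lt_of_lt_of_le hx.2 hrs⟩)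
  have hE0 : ∀ r, 1 ≤ r → 0 ≤ E r := fun r _ =>
    setIntegral_nonneg ((measurableSet_zSlab L 0).inter
      (isOpen_lt continuous_cylRadius continuous_const).measurableSet) fun x _ => hF0 x
  have hEA : ∀ r, 1 ≤ r → E r ≤ 3 * K₁ ^ 2 * (8 * L) * r ^ 2 := by
    intro r hr
    have hr0 : 0 < r := by linarith
    have hvol := volume_zSlab_inter_cyl_le hL hr0
    have hfin : volume (zSlab L 0 ∩ {x | cylRadius x < r}) ≠ ⊤ :=
      (lt_of_le_of_lt hvol ENNReal.ofReal_lt_top).ne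
    have hmeas : MeasurableSet (zSlab L 0 ∩ {x : EuclideanSpace ℝ (Fin 3) | cylRadius x < r}) :=
      (measurableSet_zSlab L 0).inter (isOpen_lt continuous_cylRadius continuous_const).measurableSet
    calc E r ≤ ∫ x in zSlab L 0 ∩ {x | cylRadius x < r}, (3 * K₁ ^ 2 : ℝ) := by
          refine setIntegral_mono_on (hEint r hr0) ?_ hmeas fun x _ => ?_
          · exact integrableOn_const hfin
          · exact hFB' x
      _ = (volume (zSlab L 0 ∩ {x | cylRadius x < r})).toReal * (3 * K₁ ^ 2) := by
          rw [setIntegral_const, smul_eq_mul, measureReal_def]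
      _ ≤ (8 * L * r ^ 2) * (3 * K₁ ^ 2) :=
          mul_le_mul_of_nonneg_right (ENNReal.toReal_le_of_le_ofReal (by positivity) hvol)
            (by positivity)
      _ = 3 * K₁ ^ 2 * (8 * L) * r ^ 2 := by ring
  -- `E ≡ 0`, `DU ≡ 0`, `U` constant
  have hEzero : ∀ r, 1 ≤ r → E r = 0 :=
    saintVenant_dyadic one_pos le_rfl ha hc hmono hE0 hEA hineq
  have hFzero : ∀ x, F x = 0 :=
    eq_zero_of_setIntegral_zSlab_eq_zero hL hFc hF0 hFper hFB hEzero
  have hDU : ∀ x, fderiv ℝ U x = 0 := fun x => eq_zero_of_frobeniusNormSq_eq_zero (hFzero x)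
  exact ⟨U 0, funext fun x => is_const_of_fderiv_eq_zero hUd hDU x 0⟩

/-- **Bounded periodic steady flows with mean-free radial velocity are constant**, any
viscosity `ν > 0` (scaling `(U, P) ↦ (ν⁻¹U, ν⁻²P)`). This is the common core of Han–Wang–Xie 2023
Thm 1.1 (row S6) and of Bang–Gui–Wang–Xie 2025 Thm 1.4 (a), (b) (row S7).
[cite: HanWangXie2023, Thm 1.1, proof §3; BangGuiWangXie2025, Thm 1.4 (d), proof §5 (source of the ARGUMENT this module implements; this declaration is the cell’s own lemma or plumbing, NOT a printed statement)] -/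
theorem periodicSlab_liouville_of_radial_verticalMean {ν L : ℝ} (hν : 0 < ν) (hL : 0 < L)
    {U : EuclideanSpace ℝ (Fin 3) → EuclideanSpace ℝ (Fin 3)} {P : EuclideanSpace ℝ (Fin 3) → ℝ}
    (hprof : IsLerayProfile ν 0 U P) (hU : ContDiff ℝ (⊤ : ℕ∞) U) (hP : ContDiff ℝ (⊤ : ℕ∞) P)
    (hbd : ∃ M : ℝ, ∀ x, ‖U x‖ ≤ M) (hper : IsAxiallyPeriodic L U)
    (hmean : ∀ x, ∫ s in (0 : ℝ)..L, ⟪horizPart x, U (x + s • eZ)⟫ = 0) :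
    ∃ C : EuclideanSpace ℝ (Fin 3), U = fun _ => C := by
  obtain ⟨M, hM⟩ := hbd
  set V : EuclideanSpace ℝ (Fin 3) → EuclideanSpace ℝ (Fin 3) := fun x => ν⁻¹ • U x with hV
  set Q : EuclideanSpace ℝ (Fin 3) → ℝ := fun x => ν⁻¹ ^ 2 • P x with hQ
  have hprof1 : IsLerayProfile 1 0 V Q := hprof.inv_smul_viscosity hν.ne'
  have hVs : ContDiff ℝ (⊤ : ℕ∞) V := hU.const_smul ν⁻¹
  have hQs : ContDiff ℝ (⊤ : ℕ∞) Q := hP.const_smul (ν⁻¹ ^ 2)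
  have hVbd : ∃ M' : ℝ, ∀ x, ‖V x‖ ≤ M' := ⟨|ν⁻¹| * M, fun x => by
    show ‖ν⁻¹ • U x‖ ≤ |ν⁻¹| * M
    rw [norm_smul, Real.norm_eq_abs]
    exact mul_le_mul_of_nonneg_left (hM x) (abs_nonneg _)⟩
  have hVper : IsAxiallyPeriodic L V := fun x => by
    show ν⁻¹ • U (x + L • EuclideanSpace.single 2 (1 : ℝ)) = ν⁻¹ • U x
    rw [hper x]
  have hVmean : ∀ x, ∫ s in (0 : ℝ)..L, ⟪horizPart x, V (x + s • eZ)⟫ = 0 := fun x => by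
    have e : (fun s : ℝ => ⟪horizPart x, V (x + s • eZ)⟫) =
        fun s : ℝ => ν⁻¹ * ⟪horizPart x, U (x + s • eZ)⟫ := by
      funext s; simp only [hV, real_inner_smul_right]
    rw [e, intervalIntegral.integral_const_mul, hmean x, mul_zero]
  obtain ⟨C, hC⟩ := periodicSlab_liouville_of_radial_verticalMean_one hL hprof1 hVs hQs hVbd hVper hVmean
  refine ⟨ν • C, funext fun x => ?_⟩
  have hx : ν⁻¹ • U x = C := congrFun hC x
  have := congrArg (fun v => ν • v) hx
  simpa [smul_smul, mul_inv_cancel₀ hν.ne'] using this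

end Literature.Analysis.SteadySlabLiouville.PeriodicSlab

end Part1

/-!
## Part 2 — port of `Summits/NavierStokesRegularity/NavierStokesRegularity/Theorems/ScenarioCensusPeriodicSlabSwirlFlux.lean` (5 declarations kept)

# Census row S7 (a): flows whose swirl velocity is axisymmetric have mean-free radial velocity
# on vertical periods

Support file for the scenario census of `NavierStokesRegularity` (cell `pub/ns-census`, block S,
row S7 = Bang–Gui–Wang–Xie, J. Fluid Mech. 1005 (2025) A6 = arXiv:2205.13259, Thm 1.4; tree FACT
`Literature.Analysis.FluidPDE.BangGuiWangXie2025_periodicSlab_liouville`). Case (a) of the printed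
theorem ("`u^θ` is independent of `θ`") starts (§6, proof of Lemma 5.2, Step 1) from "Due to the
divergence free property of `u` and the fact that `u^θ` is independent of `θ`, one has
`∂_r ∫₀¹ r u^r dz = −∫₀¹ ∂_z(r u^z) dz = 0` … This implies `∫₀¹ r u^r dz = 0`." Here is that
statement in Cartesian vocabulary (`r u^r = ⟪x_h, U⟫`, `r u^θ = swirl U`):

* `radial_verticalMean_eq_zero_of_swirl_axisymmetric` — for `U ∈ C¹` with bounded derivative,
  divergence free, axially `L`-periodic, whose swirl `Γ = swirl U` is an axisymmetric scalar:
  `∫₀ᴸ ⟪x_h, U(x + s e₃)⟫ ds = 0` for every `x`;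
* `isAxisymmetricScalar_swirl_of_swirlVelocity` — the printed hypothesis (`u^θ` axisymmetric)
  implies the axisymmetry of `Γ = r u^θ`;
* `eq_smul_eZ_of_const_of_swirlVelocity` — a CONSTANT field with axisymmetric `u^θ` is axial.

Proof of the first: for the vertical period integral `g` (`C¹`, `∂₃g = 0`, `div g = 0`,
`…HelicalSlabFlux`), the swirl `swirl g = ∫₀ᴸ Γ(· + s e₃) ds` is axisymmetric, so
`D(swirl g)(x)[Jx] = 0`, i.e. `⟪Jx, Dg(x) Jx⟫ = ⟪x_h, g x⟫`; with the trace identity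
`⟪Dg x_h, x_h⟫ + ⟪Dg Jx, Jx⟫ = r² (∂₁g₁ + ∂₂g₂) = −r² ∂₃g₃ = 0` this gives
`⟪Dg x_h, x_h⟫ + ⟪x_h, g⟫ = 0`, so `⟪x_h, g⟫` is constant along horizontal rays, hence `0`.

No summit statement and no census row is proved in this file.

## References

* J. Bang, C. Gui, Y. Wang, C. Xie, arXiv:2205.13259, §6 (proof of Lemma 5.2, Step 1; proof of
  Thm 1.4, Step 1). [BangGuiWangXie2025]
-/

section Part2

open _root_.MeasureTheory _root_.Set _root_.Function _root_.Filter
open scoped _root_.Topology _root_.InnerProductSpace RealInnerProductSpace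

namespace Literature.Analysis.SteadySlabLiouville.PeriodicSlab

open Literature.Analysis Literature.Analysis.FluidPDE
open Literature.Analysis.SteadySlabLiouville.HelicalSlab

/-! ### Small algebra of the rotation generator -/

/-- `J(J x) = −x_h`.
[cite: BangGuiWangXie2025, Thm 1.4 (a), proof §5 (source of the ARGUMENT this module implements; this declaration is the cell’s own lemma or plumbing, NOT a printed statement)] -/
theorem rotGen_rotGen_eq_neg_horizPart (x : EuclideanSpace ℝ (Fin 3)) :
    rotGen (rotGen x) = -horizPart x := by
  rw [horizPart_eq_toLp]
  ext i
  fin_cases i <;> simp [rotGen]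

/-- `J` does not see the axial component: `J(x + s e₃) = J x`.
[cite: BangGuiWangXie2025, Thm 1.4 (a), proof §5 (source of the ARGUMENT this module implements; this declaration is the cell’s own lemma or plumbing, NOT a printed statement)] -/
theorem rotGen_add_smul_eZ (x : EuclideanSpace ℝ (Fin 3)) (s : ℝ) : rotGen (x + s • eZ) = rotGen x := by
  ext i
  fin_cases i <;> simp [rotGen, eZ]

/-- The printed hypothesis of case (a), "`u^θ` independent of `θ`", implies that the swirl
`Γ = r u^θ` is an axisymmetric scalar.
[cite: BangGuiWangXie2025, Thm 1.4 (a), proof §5 (source of the ARGUMENT this module implements; this declaration is the cell’s own lemma or plumbing, NOT a printed statement)] -/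
theorem isAxisymmetricScalar_swirl_of_swirlVelocity {U : EuclideanSpace ℝ (Fin 3) → EuclideanSpace ℝ (Fin 3)}
    (h : IsAxisymmetricScalar (swirlVelocity U)) : IsAxisymmetricScalar (swirl U) := by
  intro θ x
  by_cases hx : cylRadius x = 0
  · have hx' : cylRadius (rotZ θ x) = 0 := by rw [cylRadius_rotZ, hx]
    obtain ⟨h0, h1⟩ := (cylRadius_eq_zero_iff x).1 hx
    obtain ⟨h0', h1'⟩ := (cylRadius_eq_zero_iff (rotZ θ x)).1 hx'
    simp only [swirl, h0, h1, h0', h1', zero_mul, sub_zero]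
  · have hx' : cylRadius (rotZ θ x) ≠ 0 := by rw [cylRadius_rotZ]; exact hx
    rw [swirl_eq_cylRadius_mul_swirlVelocity U hx', swirl_eq_cylRadius_mul_swirlVelocity U hx,
      cylRadius_rotZ, h θ x]

/-- A CONSTANT field whose swirl velocity is axisymmetric is axial: `C = C₂ e₃`.
[cite: BangGuiWangXie2025, Thm 1.4 (a), proof §5 (source of the ARGUMENT this module implements; this declaration is the cell’s own lemma or plumbing, NOT a printed statement)] -/
theorem eq_smul_eZ_of_const_of_swirlVelocity {C : EuclideanSpace ℝ (Fin 3)}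
    (h : IsAxisymmetricScalar (swirlVelocity fun _ : EuclideanSpace ℝ (Fin 3) => C)) :
    C = C 2 • eZ := by
  have hsw := isAxisymmetricScalar_swirl_of_swirlVelocity h
  -- `Γ(x) = x₀ C₁ − x₁ C₀` is rotation-invariant: evaluate at `e₀`, `e₁` and their half turns
  have h1 := hsw Real.pi (EuclideanSpace.single 0 1)
  have h2 := hsw Real.pi (EuclideanSpace.single 1 1)
  simp [swirl, Real.cos_pi, Real.sin_pi] at h1 h2
  ext i
  fin_cases i <;> simp [eZ] <;> linarith

/-! ### The flux lemma under axisymmetry of the swirl -/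

/-- **Flows with axisymmetric swirl have mean-free radial velocity on vertical periods**
(Bang–Gui–Wang–Xie, §6 Step 1, Cartesian form). Let `U ∈ C¹(ℝ³; ℝ³)` have bounded derivative, be
divergence free and axially `L`-periodic, and let its swirl `swirl U = r u^θ` be an axisymmetric
scalar. Then `∫₀ᴸ ⟪x_h, U(x + s e₃)⟫ ds = 0` for every `x`.
[cite: BangGuiWangXie2025, Thm 1.4 (a), proof §5 (source of the ARGUMENT this module implements; this declaration is the cell’s own lemma or plumbing, NOT a printed statement)] -/
theorem radial_verticalMean_eq_zero_of_swirl_axisymmetric {L : ℝ}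
    {U : EuclideanSpace ℝ (Fin 3) → EuclideanSpace ℝ (Fin 3)} (hU : ContDiff ℝ 1 U) {K : ℝ}
    (hK : ∀ x, ‖fderiv ℝ U x‖ ≤ K) (hdiv : VectorCalculus.IsDivFree U)
    (hper : IsAxiallyPeriodic L U) (hsw : IsAxisymmetricScalar (swirl U))
    (x : EuclideanSpace ℝ (Fin 3)) :
    ∫ s in (0 : ℝ)..L, ⟪horizPart x, U (x + s • eZ)⟫ = 0 := by
  have hUc : Continuous U := hU.continuous
  have hUd : Differentiable ℝ U := hU.differentiable one_ne_zero
  have hDUc : Continuous (fderiv ℝ U) := hU.continuous_fderiv one_ne_zero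
  have hline : ∀ y : EuclideanSpace ℝ (Fin 3), Continuous fun s : ℝ => y + s • (eZ : EuclideanSpace ℝ (Fin 3)) :=
    fun y => continuous_const.add (continuous_id.smul continuous_const)
  -- the averaged field and its derivative
  set g : EuclideanSpace ℝ (Fin 3) → EuclideanSpace ℝ (Fin 3) := fun y => ∫ s in (0 : ℝ)..L, U (y + s • eZ)
    with hg
  set Dg : EuclideanSpace ℝ (Fin 3) → (EuclideanSpace ℝ (Fin 3) →L[ℝ] EuclideanSpace ℝ (Fin 3)) :=
    fun y => ∫ s in (0 : ℝ)..L, fderiv ℝ U (y + s • eZ) with hDg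
  have hgD : ∀ y, HasFDerivAt g (Dg y) y := fun y => hasFDerivAt_verticalIntegral hU hK y
  have hgd : Differentiable ℝ g := fun y => (hgD y).differentiableAt
  have hgF : ∀ y, fderiv ℝ g y = Dg y := fun y => (hgD y).fderiv
  have hDint : ∀ y, IntervalIntegrable (fun s : ℝ => fderiv ℝ U (y + s • eZ)) volume 0 L :=
    fun y => (hDUc.comp (hline y)).intervalIntegrable _ _
  have hgz : ∀ (y : EuclideanSpace ℝ (Fin 3)) (t : ℝ), g (y + t • eZ) = g y :=
    fun y t => verticalIntegral_add_smul_eZ hper y t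
  -- `div g = 0`
  set τ : (EuclideanSpace ℝ (Fin 3) →L[ℝ] EuclideanSpace ℝ (Fin 3)) →L[ℝ] ℝ :=
    LinearMap.toContinuousLinearMap
      ((LinearMap.trace ℝ (EuclideanSpace ℝ (Fin 3))).comp (ContinuousLinearMap.coeLM ℝ)) with hτ
  have hτ_apply : ∀ T : EuclideanSpace ℝ (Fin 3) →L[ℝ] EuclideanSpace ℝ (Fin 3),
      τ T = LinearMap.trace ℝ _ (T : EuclideanSpace ℝ (Fin 3) →ₗ[ℝ] EuclideanSpace ℝ (Fin 3)) :=
    fun T => rfl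
  have hdivg : ∀ y, VectorCalculus.divergence g y = 0 := fun y => by
    rw [VectorCalculus.divergence, hgF y, ← hτ_apply, hDg, ← τ.intervalIntegral_comp_comm (hDint y)]
    have : (fun s : ℝ => τ (fderiv ℝ U (y + s • eZ))) = fun _ => (0 : ℝ) := by
      funext s
      rw [hτ_apply]
      exact hdiv (y + s • eZ)
    rw [this, intervalIntegral.integral_const, smul_zero]
  -- `Dg(y) e₃ = 0`
  have hDg_eZ : ∀ y, fderiv ℝ g y eZ = 0 := fun y => by
    have h1 : HasDerivAt (fun t : ℝ => g (y + t • eZ)) (fderiv ℝ g (y + (0 : ℝ) • eZ) eZ) 0 :=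
      hasDerivAt_comp_add_smul_eZ hgd y 0
    have h2 : (fun t : ℝ => g (y + t • eZ)) = fun _ => g y := funext fun t => hgz y t
    rw [h2, zero_smul, add_zero] at h1
    exact h1.unique (hasDerivAt_const (0 : ℝ) (g y))
  -- the swirl of `g` is axisymmetric: `swirl g (y) = ∫₀ᴸ Γ(y + s e₃) ds`
  have hsw_g : IsAxisymmetricScalar (swirl g) := by
    have hrepr : ∀ y, swirl g y = ∫ s in (0 : ℝ)..L, swirl U (y + s • eZ) := by
      intro y
      rw [swirl_eq_inner_rotGen]
      show innerSL ℝ (rotGen y) (∫ s in (0 : ℝ)..L, U (y + s • eZ)) = _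
      have hint : IntervalIntegrable (fun s : ℝ => U (y + s • eZ)) volume 0 L :=
        (hUc.comp (hline y)).intervalIntegrable _ _
      rw [← (innerSL ℝ (rotGen y)).intervalIntegral_comp_comm hint]
      refine intervalIntegral.integral_congr fun s _ => ?_
      simp only [innerSL_apply_apply, swirl_eq_inner_rotGen, rotGen_add_smul_eZ]
    intro θ y
    rw [hrepr, hrepr]
    refine intervalIntegral.integral_congr fun s _ => ?_
    show swirl U (rotZ θ y + s • eZ) = swirl U (y + s • eZ)
    rw [← rotZ_add_smul_eZ, hsw θ]
  -- infinitesimal form: `⟪J y, Dg(y) J y⟫ = ⟪y_h, g y⟫`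
  have hinf : ∀ y, ⟪rotGen y, fderiv ℝ g y (rotGen y)⟫ = ⟪horizPart y, g y⟫ := by
    intro y
    have h1 : fderiv ℝ (swirl g) y (rotGen y) = 0 := hsw_g.fderiv_rotGen (differentiableAt_swirl (hgd y))
    rw [fderiv_swirl_apply (hgd y), rotGen_rotGen_eq_neg_horizPart, inner_neg_left] at h1
    linarith
  -- the key identity `⟪Dg(y) y_h, y_h⟫ + ⟪y_h, g y⟫ = 0`
  set b := EuclideanSpace.basisFun (Fin 3) ℝ with hb
  have key : ∀ y : EuclideanSpace ℝ (Fin 3),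
      ⟪fderiv ℝ g y (horizPart y), horizPart y⟫ + ⟪horizPart y, g y⟫ = 0 := by
    intro y
    set G := fderiv ℝ g y with hG
    have hb0 : b 0 = EuclideanSpace.single 0 (1 : ℝ) := by simp [hb]
    have hb1 : b 1 = EuclideanSpace.single 1 (1 : ℝ) := by simp [hb]
    have hb2 : b 2 = EuclideanSpace.single 2 (1 : ℝ) := by simp [hb]
    -- trace
    have htr : ⟪b 0, G (b 0)⟫ + ⟪b 1, G (b 1)⟫ + ⟪b 2, G (b 2)⟫ = 0 := by
      have h := divergence_eq_sum_inner_fderiv b g y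
      rw [hdivg y, Fin.sum_univ_three] at h
      rw [hG]; linarith
    have htr' : G (b 0) 0 + G (b 1) 1 + G (b 2) 2 = 0 := by
      have h := htr
      rw [hb0, hb1, hb2] at h ⊢
      simpa [EuclideanSpace.inner_single_left] using h
    -- axial column vanishes
    have hcol : G (b 2) = 0 := by rw [hb2, hG]; exact hDg_eZ y
    have hG22 : G (b 2) 2 = 0 := by rw [hcol]; rfl
    -- the swirl identity in coordinates
    have hsw' := hinf y
    rw [← hG, rotGen_eq_sub_single, map_sub, map_smul, map_smul, ← hb0, ← hb1] at hsw'
    rw [inner_horizPart_left] at hsw'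
    have e0 : ⟪y 0 • b 1 - y 1 • b 0, y 0 • G (b 1) - y 1 • G (b 0)⟫ =
        y 0 * (y 0 * G (b 1) 1 - y 1 * G (b 0) 1) - y 1 * (y 0 * G (b 1) 0 - y 1 * G (b 0) 0) := by
      rw [hb0, hb1]
      simp only [inner_sub_left, inner_sub_right, real_inner_smul_left, real_inner_smul_right,
        EuclideanSpace.inner_single_left, map_one, one_mul]
      ring
    rw [e0] at hsw'
    -- expand the goal in coordinates
    have hhp : horizPart y = y 0 • b 0 + y 1 • b 1 := by
      rw [horizPart_eq_toLp, hb0, hb1]; ext i; fin_cases i <;> simp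
    have e1 : ⟪G (horizPart y), horizPart y⟫ =
        y 0 * (y 0 * G (b 0) 0 + y 1 * G (b 1) 0) + y 1 * (y 0 * G (b 0) 1 + y 1 * G (b 1) 1) := by
      rw [real_inner_comm, inner_horizPart_left, hhp, map_add, map_smul, map_smul]
      simp only [PiLp.add_apply, PiLp.smul_apply, smul_eq_mul]
    have e2 : ⟪horizPart y, g y⟫ = y 0 * g y 0 + y 1 * g y 1 := inner_horizPart_left y (g y)
    rw [e1, e2]
    linear_combination (y 0 ^ 2 + y 1 ^ 2) * htr' - (y 0 ^ 2 + y 1 ^ 2) * hG22 - hsw'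
  -- the flux function `h(y) = ⟪y_h, g y⟫` along the horizontal ray through `x`
  set h : EuclideanSpace ℝ (Fin 3) → ℝ := fun y => ⟪horizPart y, g y⟫ with hh
  have hhd : ∀ y, HasFDerivAt h ((innerSL ℝ (horizPart y)).comp (fderiv ℝ g y) +
      (innerSL ℝ (g y)).comp horizPart) y := by
    intro y
    refine ((horizPart.hasFDerivAt (x := y)).inner ℝ (hgd y).hasFDerivAt).congr_fderiv ?_
    ext v
    simp only [_root_.add_apply, ContinuousLinearMap.comp_apply, innerSL_apply_apply,
      fderivInnerCLM_apply, ContinuousLinearMap.prod_apply]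
    rw [real_inner_comm (g y)]
  have hhD : ∀ y v, fderiv ℝ h y v = ⟪horizPart y, fderiv ℝ g y v⟫ + ⟪g y, horizPart v⟫ := by
    intro y v
    rw [(hhd y).fderiv]
    simp only [_root_.add_apply, ContinuousLinearMap.comp_apply, innerSL_apply_apply]
  set c : EuclideanSpace ℝ (Fin 3) := (x 2) • eZ with hc
  have hc0 : horizPart c = 0 := by rw [hc, map_smul, horizPart_eZ, smul_zero]
  have hray : ∀ t : ℝ, horizPart (c + t • horizPart x) = t • horizPart x := by
    intro t; rw [map_add, hc0, zero_add, map_smul, horizPart_horizPart]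
  set ψ : ℝ → ℝ := fun t => h (c + t • horizPart x) with hψ
  have hψd : ∀ t, HasDerivAt ψ (fderiv ℝ h (c + t • horizPart x) (horizPart x)) t := by
    intro t
    have hl : HasDerivAt (fun τ : ℝ => c + τ • horizPart x) (horizPart x) t := by
      have := ((hasDerivAt_id t).smul_const (horizPart x)).const_add c
      simpa using this
    exact ((hhd _).comp_hasDerivAt t hl).congr_deriv (by rw [(hhd _).fderiv])
  -- off the axis the derivative along the ray vanishes
  have hψ0 : ∀ t : ℝ, t ≠ 0 → fderiv ℝ h (c + t • horizPart x) (horizPart x) = 0 := by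
    intro t ht
    set y := c + t • horizPart x with hy
    have hyh : horizPart y = t • horizPart x := hray t
    have hk := key y
    rw [hyh] at hk
    simp only [map_smul, real_inner_smul_left, real_inner_smul_right] at hk
    have e3 : ⟪horizPart x, fderiv ℝ g y (horizPart x)⟫ = ⟪fderiv ℝ g y (horizPart x), horizPart x⟫ :=
      real_inner_comm _ _
    have e4 : ⟪g y, horizPart x⟫ = ⟪horizPart x, g y⟫ := real_inner_comm _ _
    rw [hhD, hyh, real_inner_smul_left, horizPart_horizPart, e3, e4]
    have h0 : t * (t * ⟪fderiv ℝ g y (horizPart x), horizPart x⟫ + ⟪horizPart x, g y⟫) = 0 := by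
      linear_combination hk
    rcases mul_eq_zero.1 h0 with h1 | h1
    · exact absurd h1 ht
    · exact h1
  -- mean value theorem on `[0, 1]`
  have hψcont : ContinuousOn ψ (Icc 0 1) := fun t _ => (hψd t).continuousAt.continuousWithinAt
  have hψdiff : DifferentiableOn ℝ ψ (Ioo 0 1) := fun t _ => (hψd t).differentiableAt.differentiableWithinAt
  obtain ⟨t₀, ht₀, hslope⟩ := exists_deriv_eq_slope ψ zero_lt_one hψcont hψdiff
  rw [(hψd t₀).deriv, hψ0 t₀ (ne_of_gt ht₀.1)] at hslope
  have hψ01 : ψ 1 = ψ 0 := by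
    have : (ψ 1 - ψ 0) / (1 - 0) = 0 := hslope.symm
    rw [sub_zero, div_one] at this
    linarith
  have hψ0' : ψ 0 = 0 := by
    simp only [hψ, zero_smul, add_zero, hh, hc0, inner_zero_left]
  have hψ1 : ψ 1 = ∫ s in (0 : ℝ)..L, ⟪horizPart x, U (x + s • eZ)⟫ := by
    have hxc : c + (1 : ℝ) • horizPart x = x := by
      rw [one_smul, hc, add_comm]; exact horizPart_add_apply_two_smul_eZ x
    simp only [hψ, hh, hxc, hg]
    show innerSL ℝ (horizPart x) (∫ s in (0 : ℝ)..L, U (x + s • eZ)) = _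
    have hint : IntervalIntegrable (fun s : ℝ => U (x + s • eZ)) volume 0 L :=
      (hUc.comp (hline x)).intervalIntegrable _ _
    rw [← (innerSL ℝ (horizPart x)).intervalIntegral_comp_comm hint]
    simp only [innerSL_apply_apply]
  rw [← hψ1, hψ01, hψ0']

end Literature.Analysis.SteadySlabLiouville.PeriodicSlab

end Part2

/-!
## Part 3 — port of `Summits/NavierStokesRegularity/NavierStokesRegularity/Theorems/ScenarioCensusPeriodicSlabSwirlLiouville.lean` (1 declarations kept)

# Census row S7, case (a): bounded periodic steady flows with axisymmetric swirl velocity are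
# axial constants (Bang–Gui–Wang–Xie 2025, Thm 1.4 (a))

Support file for the scenario census of `NavierStokesRegularity` (cell `pub/ns-census`, block S,
row S7 = Bang–Gui–Wang–Xie, J. Fluid Mech. 1005 (2025) A6 = arXiv:2205.13259, Thm 1.4; tree FACT
`Literature.Analysis.FluidPDE.BangGuiWangXie2025_periodicSlab_liouville`, first conjunct, first
disjunct). **Theorem** (`periodicSlab_liouville_swirlAxisymmetric`): for `ν > 0`, `L > 0`, a
smooth steady Navier–Stokes flow `(U, P)` on `ℝ³` (`IsLerayProfile ν 0 U P`, `U, P ∈ C^∞`),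
bounded, axially `L`-periodic, whose swirl velocity `u^θ = swirlVelocity U` is an axisymmetric
scalar ("`u^θ` is independent of `θ`"), is an axial constant `U ≡ c e₃`. In particular
(`periodicSlab_liouville_axisymmetric`) every bounded AXISYMMETRIC smooth steady flow which is
periodic along the axis is `(0, 0, c)` (loc. cit., the remark after Thm 1.4).

Proof: the swirl is axisymmetric, so the radial velocity has zero vertical period means
(`radial_verticalMean_eq_zero_of_swirl_axisymmetric`, BGWX §6 Step 1); hence `U` is constant
(`periodicSlab_liouville_of_radial_verticalMean`: periodic pressure, Poincaré–Wirtinger on vertical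
periods, foot-point splitting of the pressure, dyadic Saint-Venant — the S6 chain), and a constant
field with axisymmetric `u^θ` is axial. No Bogovskiĭ map is used.

No summit statement is proved in this file; the census value of row S7 / a sub-row S7a is the
lead's call.

## References

* J. Bang, C. Gui, Y. Wang, C. Xie, arXiv:2205.13259, Thm 1.4 (a) and §6. [BangGuiWangXie2025]

Not carried from this source module (not needed by the declarations re-homed here; their consumers are Summits-side): `periodicSlab_liouville_axisymmetric`.
-/

section Part3

open _root_.MeasureTheory _root_.Set _root_.Function _root_.Filter
open scoped _root_.Topology _root_.InnerProductSpace RealInnerProductSpace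

namespace Literature.Analysis.SteadySlabLiouville.PeriodicSlab

open Literature.Analysis Literature.Analysis.FluidPDE
open Literature.Analysis.SteadySlabLiouville.HelicalSlab

/-- **Bang–Gui–Wang–Xie 2025, Thm 1.4 (a).** Let `ν > 0`, `L > 0`, and let `(U, P)` be a smooth
steady solution of the unforced Navier–Stokes system on `ℝ³` (`IsLerayProfile ν 0 U P`,
`U, P ∈ C^∞`), bounded and axially `L`-periodic, whose swirl velocity `swirlVelocity U = u^θ` is
an axisymmetric scalar. Then `U ≡ c e₃` for some real `c`.
[cite: BangGuiWangXie2025, Thm 1.4 (a), proof §5 (source of the ARGUMENT this module implements; this declaration is the cell’s own lemma or plumbing, NOT a printed statement)] -/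
theorem periodicSlab_liouville_swirlAxisymmetric {ν L : ℝ} (hν : 0 < ν) (hL : 0 < L)
    {U : EuclideanSpace ℝ (Fin 3) → EuclideanSpace ℝ (Fin 3)} {P : EuclideanSpace ℝ (Fin 3) → ℝ}
    (hprof : IsLerayProfile ν 0 U P) (hU : ContDiff ℝ (⊤ : ℕ∞) U) (hP : ContDiff ℝ (⊤ : ℕ∞) P)
    (hbd : ∃ M : ℝ, ∀ x, ‖U x‖ ≤ M) (hper : IsAxiallyPeriodic L U)
    (hsw : IsAxisymmetricScalar (swirlVelocity U)) :
    ∃ c : ℝ, U = fun _ => c • eZ := by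
  obtain ⟨M, hM⟩ := hbd
  have hst : IsSteadyClassicalNS ν 0 U P := isSteadyClassicalNS_of_isLerayProfile hprof hU hP
  obtain ⟨K₁, K₂, K₃, -, -, -, hK⟩ := steady_derivative_bounds hν hst hM
  have hU1 : ContDiff ℝ 1 U := contDiff_infty.1 hU 1
  have hmean := radial_verticalMean_eq_zero_of_swirl_axisymmetric hU1 (fun x => (hK x).1)
    hst.divFree hper (isAxisymmetricScalar_swirl_of_swirlVelocity hsw)
  obtain ⟨C, hC⟩ := periodicSlab_liouville_of_radial_verticalMean hν hL hprof hU hP ⟨M, hM⟩ hper hmean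
  have hswC : IsAxisymmetricScalar (swirlVelocity fun _ : EuclideanSpace ℝ (Fin 3) => C) := by
    rw [← hC]; exact hsw
  have hCe : C = C 2 • eZ := eq_smul_eZ_of_const_of_swirlVelocity hswC
  exact ⟨C 2, by rw [hC]; funext x; exact hCe⟩

end Literature.Analysis.SteadySlabLiouville.PeriodicSlab

end Part3

/-!
## Part 4 — port of `Summits/NavierStokesRegularity/NavierStokesRegularity/Theorems/ScenarioCensusPeriodicSlabRadialFlux.lean` (4 declarations kept)

# Census row S7 (b): flows whose radial velocity is axisymmetric have mean-free radial velocity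
# on vertical periods

Support file for the scenario census of `NavierStokesRegularity` (cell `pub/ns-census`, block S,
row S7 = Bang–Gui–Wang–Xie, J. Fluid Mech. 1005 (2025) A6 = arXiv:2205.13259, Thm 1.4; tree FACT
`Literature.Analysis.FluidPDE.BangGuiWangXie2025_periodicSlab_liouville`). Case (b) of the printed
theorem ("`u^r` is independent of `θ`"), §6 Step 2: "Using the divergence free property of `u`,
one has `∂_r ∫₀¹∫₀^{2π} r u^r dθ dz = 0` … Since `u^r` is independent of `θ`, it holds that
`∫₀¹ r u^r dz = (2π)⁻¹ ∫₀¹∫₀^{2π} r u^r dθ dz = 0`." In Cartesian vocabulary: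

* `inner_horizPart_eq_zero_of_isAxisymmetric_of_divergence_eq_zero` — the flux core shared with
  rows S6 / S7(a): a differentiable AXISYMMETRIC field `g` with `div g = 0` and `∂₃g = 0` has no
  radial part, `⟪x_h, g x⟫ = 0`;
* `radial_verticalMean_eq_zero_of_radialVelocity_axisymmetric` — for `U ∈ C¹` with bounded
  derivative, divergence free, axially `L`-periodic, with `radialVelocity U = u^r` an axisymmetric
  scalar: `∫₀ᴸ ⟪x_h, U(x + s e₃)⟫ ds = 0` for every `x` (apply the core to the ANGULAR MEAN
  `⟨g⟩_θ` of the vertical period integral `g`, `Literature.Analysis.FluidPDE.angularMeanVec`: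
  it is axisymmetric, `C¹`, divergence free and `z`-independent, and its radial part is that of
  `g` because `⟪x_h, g⟫` is rotation-invariant);

No summit statement and no census row is proved in this file.

## References

* J. Bang, C. Gui, Y. Wang, C. Xie, arXiv:2205.13259, §6 (proof of Thm 1.4, Step 2).
  [BangGuiWangXie2025]
* E. Pineau, V. Vicol (2026), §6.1 (6.4) (the angular mean of a vector field; tree
  `PineauVicolAngularMean`). [PineauVicol2026]
-/

section Part4

open _root_.MeasureTheory _root_.Set _root_.Function _root_.Filter
open scoped _root_.Topology _root_.InnerProductSpace RealInnerProductSpace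

namespace Literature.Analysis.SteadySlabLiouville.PeriodicSlab

open Literature.Analysis Literature.Analysis.FluidPDE
open Literature.Analysis.SteadySlabLiouville.HelicalSlab

/-! ### The flux core: axisymmetric, divergence-free, `z`-independent fields have no radial part -/

/-- **Axisymmetric divergence-free fields with `∂₃g = 0` have no radial part.** For a
differentiable `g : ℝ³ → ℝ³` with `div g = 0`, `Dg(x) e₃ = 0` and `g(R_θ x) = R_θ g(x)`:
`⟪x_h, g x⟫ = 0` for all `x`. (Infinitesimal axisymmetry `Dg(x)[Jx] = J g(x)` and the trace
identity give `⟪Dg x_h, x_h⟫ + ⟪x_h, g⟫ = 0`, so `⟪x_h, g⟫` is constant along horizontal rays and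
vanishes on the axis.)
[cite: BangGuiWangXie2025, Thm 1.4 (b), proof §5 (source of the ARGUMENT this module implements; this declaration is the cell’s own lemma or plumbing, NOT a printed statement)] -/
theorem inner_horizPart_eq_zero_of_isAxisymmetric_of_divergence_eq_zero
    {g : EuclideanSpace ℝ (Fin 3) → EuclideanSpace ℝ (Fin 3)} (hgd : Differentiable ℝ g)
    (hdiv : ∀ y, VectorCalculus.divergence g y = 0) (hz : ∀ y, fderiv ℝ g y eZ = 0)
    (hax : IsAxisymmetric g) (x : EuclideanSpace ℝ (Fin 3)) : ⟪horizPart x, g x⟫ = 0 := by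
  have hDg_rot : ∀ y, fderiv ℝ g y (rotGen y) = rotGen (g y) := fun y => hax.fderiv_rotGen (hgd y)
  set b := EuclideanSpace.basisFun (Fin 3) ℝ with hb
  -- the key identity `⟪Dg(y) y_h, y_h⟫ + ⟪y_h, g y⟫ = 0`
  have key : ∀ y : EuclideanSpace ℝ (Fin 3),
      ⟪fderiv ℝ g y (horizPart y), horizPart y⟫ + ⟪horizPart y, g y⟫ = 0 := by
    intro y
    set G := fderiv ℝ g y with hG
    have hb0 : b 0 = EuclideanSpace.single 0 (1 : ℝ) := by simp [hb]
    have hb1 : b 1 = EuclideanSpace.single 1 (1 : ℝ) := by simp [hb]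
    have hb2 : b 2 = EuclideanSpace.single 2 (1 : ℝ) := by simp [hb]
    have htr : ⟪b 0, G (b 0)⟫ + ⟪b 1, G (b 1)⟫ + ⟪b 2, G (b 2)⟫ = 0 := by
      have h := divergence_eq_sum_inner_fderiv b g y
      rw [hdiv y, Fin.sum_univ_three] at h
      rw [hG]; linarith
    have htr' : G (b 0) 0 + G (b 1) 1 + G (b 2) 2 = 0 := by
      have h := htr
      rw [hb0, hb1, hb2] at h ⊢
      simpa [EuclideanSpace.inner_single_left] using h
    have hcol : G (b 2) = 0 := by rw [hb2, hG]; exact hz y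
    have hG22 : G (b 2) 2 = 0 := by rw [hcol]; rfl
    have hrot := hDg_rot y
    rw [← hG, rotGen_eq_sub_single, map_sub, map_smul, map_smul, ← hb0, ← hb1] at hrot
    have hr0 := congrArg (fun w : EuclideanSpace ℝ (Fin 3) => w 0) hrot
    have hr1 := congrArg (fun w : EuclideanSpace ℝ (Fin 3) => w 1) hrot
    simp only [PiLp.sub_apply, PiLp.smul_apply, smul_eq_mul, rotGen_apply_zero, rotGen_apply_one] at hr0 hr1
    have hhp : horizPart y = y 0 • b 0 + y 1 • b 1 := by
      rw [horizPart_eq_toLp, hb0, hb1]; ext i; fin_cases i <;> simp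
    have e1 : ⟪G (horizPart y), horizPart y⟫ =
        y 0 * (y 0 * G (b 0) 0 + y 1 * G (b 1) 0) + y 1 * (y 0 * G (b 0) 1 + y 1 * G (b 1) 1) := by
      rw [real_inner_comm, inner_horizPart_left, hhp, map_add, map_smul, map_smul]
      simp only [PiLp.add_apply, PiLp.smul_apply, smul_eq_mul]
    have e2 : ⟪horizPart y, g y⟫ = y 0 * g y 0 + y 1 * g y 1 := inner_horizPart_left y (g y)
    rw [e1, e2]
    linear_combination (y 0 ^ 2 + y 1 ^ 2) * htr' - (y 0 ^ 2 + y 1 ^ 2) * hG22 +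
      y 1 * hr0 - y 0 * hr1
  -- the flux function along the horizontal ray through `x`
  set h : EuclideanSpace ℝ (Fin 3) → ℝ := fun y => ⟪horizPart y, g y⟫ with hh
  have hhd : ∀ y, HasFDerivAt h ((innerSL ℝ (horizPart y)).comp (fderiv ℝ g y) +
      (innerSL ℝ (g y)).comp horizPart) y := by
    intro y
    refine ((horizPart.hasFDerivAt (x := y)).inner ℝ (hgd y).hasFDerivAt).congr_fderiv ?_
    ext v
    simp only [_root_.add_apply, ContinuousLinearMap.comp_apply, innerSL_apply_apply,
      fderivInnerCLM_apply, ContinuousLinearMap.prod_apply]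
    rw [real_inner_comm (g y)]
  have hhD : ∀ y v, fderiv ℝ h y v = ⟪horizPart y, fderiv ℝ g y v⟫ + ⟪g y, horizPart v⟫ := by
    intro y v
    rw [(hhd y).fderiv]
    simp only [_root_.add_apply, ContinuousLinearMap.comp_apply, innerSL_apply_apply]
  set c : EuclideanSpace ℝ (Fin 3) := (x 2) • eZ with hc
  have hc0 : horizPart c = 0 := by rw [hc, map_smul, horizPart_eZ, smul_zero]
  have hray : ∀ t : ℝ, horizPart (c + t • horizPart x) = t • horizPart x := by
    intro t; rw [map_add, hc0, zero_add, map_smul, horizPart_horizPart]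
  set ψ : ℝ → ℝ := fun t => h (c + t • horizPart x) with hψ
  have hψd : ∀ t, HasDerivAt ψ (fderiv ℝ h (c + t • horizPart x) (horizPart x)) t := by
    intro t
    have hl : HasDerivAt (fun τ : ℝ => c + τ • horizPart x) (horizPart x) t := by
      have := ((hasDerivAt_id t).smul_const (horizPart x)).const_add c
      simpa using this
    exact ((hhd _).comp_hasDerivAt t hl).congr_deriv (by rw [(hhd _).fderiv])
  have hψ0 : ∀ t : ℝ, t ≠ 0 → fderiv ℝ h (c + t • horizPart x) (horizPart x) = 0 := by
    intro t ht
    set y := c + t • horizPart x with hy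
    have hyh : horizPart y = t • horizPart x := hray t
    have hk := key y
    rw [hyh] at hk
    simp only [map_smul, real_inner_smul_left, real_inner_smul_right] at hk
    have e3 : ⟪horizPart x, fderiv ℝ g y (horizPart x)⟫ = ⟪fderiv ℝ g y (horizPart x), horizPart x⟫ :=
      real_inner_comm _ _
    have e4 : ⟪g y, horizPart x⟫ = ⟪horizPart x, g y⟫ := real_inner_comm _ _
    rw [hhD, hyh, real_inner_smul_left, horizPart_horizPart, e3, e4]
    have h0 : t * (t * ⟪fderiv ℝ g y (horizPart x), horizPart x⟫ + ⟪horizPart x, g y⟫) = 0 := by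
      linear_combination hk
    rcases mul_eq_zero.1 h0 with h1 | h1
    · exact absurd h1 ht
    · exact h1
  have hψcont : ContinuousOn ψ (Icc 0 1) := fun t _ => (hψd t).continuousAt.continuousWithinAt
  have hψdiff : DifferentiableOn ℝ ψ (Ioo 0 1) := fun t _ => (hψd t).differentiableAt.differentiableWithinAt
  obtain ⟨t₀, ht₀, hslope⟩ := exists_deriv_eq_slope ψ zero_lt_one hψcont hψdiff
  rw [(hψd t₀).deriv, hψ0 t₀ (ne_of_gt ht₀.1)] at hslope
  have hψ01 : ψ 1 = ψ 0 := by
    have : (ψ 1 - ψ 0) / (1 - 0) = 0 := hslope.symm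
    rw [sub_zero, div_one] at this
    linarith
  have hψ0' : ψ 0 = 0 := by
    simp only [hψ, zero_smul, add_zero, hh, hc0, inner_zero_left]
  have hψ1 : ψ 1 = ⟪horizPart x, g x⟫ := by
    have hxc : c + (1 : ℝ) • horizPart x = x := by
      rw [one_smul, hc, add_comm]; exact horizPart_add_apply_two_smul_eZ x
    simp only [hψ, hh, hxc]
  rw [← hψ1, hψ01, hψ0']

/-! ### The radial velocity and the angular mean -/

/-- `⟪x_h, V x⟫ = r u^r(x)` (`r u^r` in junk-free polynomial form).
[cite: BangGuiWangXie2025, Thm 1.4 (b), proof §5 (source of the ARGUMENT this module implements; this declaration is the cell’s own lemma or plumbing, NOT a printed statement)] -/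
theorem inner_horizPart_eq_cylRadius_mul_radialVelocity
    (V : EuclideanSpace ℝ (Fin 3) → EuclideanSpace ℝ (Fin 3)) (x : EuclideanSpace ℝ (Fin 3)) :
    ⟪horizPart x, V x⟫ = cylRadius x * radialVelocity V x := by
  rw [radialVelocity, horizPart_eq_cylRadius_smul_eR, real_inner_smul_left, real_inner_comm]

/-- If `⟪x_h, V⟫` is rotation-invariant then so is the radial velocity `u^r = ⟪V, e_r⟫`.
[cite: BangGuiWangXie2025, Thm 1.4 (b), proof §5 (source of the ARGUMENT this module implements; this declaration is the cell’s own lemma or plumbing, NOT a printed statement)] -/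
theorem isAxisymmetricScalar_radialVelocity_of_inner_horizPart
    {V : EuclideanSpace ℝ (Fin 3) → EuclideanSpace ℝ (Fin 3)}
    (h : IsAxisymmetricScalar fun x => ⟪horizPart x, V x⟫) : IsAxisymmetricScalar (radialVelocity V) := by
  intro θ x
  have h1 := h θ x
  simp only [inner_horizPart_eq_cylRadius_mul_radialVelocity, cylRadius_rotZ] at h1
  by_cases hx : cylRadius x = 0
  · have hx' : cylRadius (rotZ θ x) = 0 := by rw [cylRadius_rotZ, hx]
    simp only [radialVelocity, eR, hx, hx', inv_zero, zero_smul, inner_zero_right]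
  · exact mul_left_cancel₀ hx h1

/-! ### The flux lemma under axisymmetry of the radial velocity -/

/-- **Flows with axisymmetric radial velocity have mean-free radial velocity on vertical
periods** (Bang–Gui–Wang–Xie, §6 Step 2, Cartesian form). Let `U ∈ C¹(ℝ³; ℝ³)` have bounded
derivative, be divergence free and axially `L`-periodic, and let `radialVelocity U = u^r` be an
axisymmetric scalar. Then `∫₀ᴸ ⟪x_h, U(x + s e₃)⟫ ds = 0` for every `x`.
[cite: BangGuiWangXie2025, Thm 1.4 (b), proof §5 (source of the ARGUMENT this module implements; this declaration is the cell’s own lemma or plumbing, NOT a printed statement)] -/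
theorem radial_verticalMean_eq_zero_of_radialVelocity_axisymmetric {L : ℝ}
    {U : EuclideanSpace ℝ (Fin 3) → EuclideanSpace ℝ (Fin 3)} (hU : ContDiff ℝ 1 U) {K : ℝ}
    (hK : ∀ x, ‖fderiv ℝ U x‖ ≤ K) (hdiv : VectorCalculus.IsDivFree U)
    (hper : IsAxiallyPeriodic L U) (hrad : IsAxisymmetricScalar (radialVelocity U))
    (x : EuclideanSpace ℝ (Fin 3)) :
    ∫ s in (0 : ℝ)..L, ⟪horizPart x, U (x + s • eZ)⟫ = 0 := by
  have hUc : Continuous U := hU.continuous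
  have hDUc : Continuous (fderiv ℝ U) := hU.continuous_fderiv one_ne_zero
  have hline : ∀ y : EuclideanSpace ℝ (Fin 3), Continuous fun s : ℝ => y + s • (eZ : EuclideanSpace ℝ (Fin 3)) :=
    fun y => continuous_const.add (continuous_id.smul continuous_const)
  -- the vertical period integral `g`, `C¹`, divergence free, `z`-independent
  set g : EuclideanSpace ℝ (Fin 3) → EuclideanSpace ℝ (Fin 3) := fun y => ∫ s in (0 : ℝ)..L, U (y + s • eZ)
    with hg
  set Dg : EuclideanSpace ℝ (Fin 3) → (EuclideanSpace ℝ (Fin 3) →L[ℝ] EuclideanSpace ℝ (Fin 3)) :=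
    fun y => ∫ s in (0 : ℝ)..L, fderiv ℝ U (y + s • eZ) with hDg
  have hgD : ∀ y, HasFDerivAt g (Dg y) y := fun y => hasFDerivAt_verticalIntegral hU hK y
  have hgd : Differentiable ℝ g := fun y => (hgD y).differentiableAt
  have hgF : ∀ y, fderiv ℝ g y = Dg y := fun y => (hgD y).fderiv
  have hgc : Continuous g := hgd.continuous
  have hDint : ∀ y, IntervalIntegrable (fun s : ℝ => fderiv ℝ U (y + s • eZ)) volume 0 L :=
    fun y => (hDUc.comp (hline y)).intervalIntegrable _ _
  have hDgc : Continuous Dg := by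
    have h := intervalIntegral.continuous_parametric_intervalIntegral_of_continuous'
      (μ := volume) (f := fun (y : EuclideanSpace ℝ (Fin 3)) (s : ℝ) => fderiv ℝ U (y + s • eZ))
      (by exact hDUc.comp (continuous_fst.add (continuous_snd.smul continuous_const))) 0 L
    exact h
  have hg1 : ContDiff ℝ 1 g := by
    rw [contDiff_one_iff_fderiv]
    refine ⟨hgd, ?_⟩
    rw [show fderiv ℝ g = Dg from funext hgF]
    exact hDgc
  have hgz : ∀ (y : EuclideanSpace ℝ (Fin 3)) (t : ℝ), g (y + t • eZ) = g y :=
    fun y t => verticalIntegral_add_smul_eZ hper y t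
  set τ : (EuclideanSpace ℝ (Fin 3) →L[ℝ] EuclideanSpace ℝ (Fin 3)) →L[ℝ] ℝ :=
    LinearMap.toContinuousLinearMap
      ((LinearMap.trace ℝ (EuclideanSpace ℝ (Fin 3))).comp (ContinuousLinearMap.coeLM ℝ)) with hτ
  have hτ_apply : ∀ T : EuclideanSpace ℝ (Fin 3) →L[ℝ] EuclideanSpace ℝ (Fin 3),
      τ T = LinearMap.trace ℝ _ (T : EuclideanSpace ℝ (Fin 3) →ₗ[ℝ] EuclideanSpace ℝ (Fin 3)) :=
    fun T => rfl
  have hdivg : ∀ y, VectorCalculus.divergence g y = 0 := fun y => by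
    rw [VectorCalculus.divergence, hgF y, ← hτ_apply, hDg, ← τ.intervalIntegral_comp_comm (hDint y)]
    have : (fun s : ℝ => τ (fderiv ℝ U (y + s • eZ))) = fun _ => (0 : ℝ) := by
      funext s
      rw [hτ_apply]
      exact hdiv (y + s • eZ)
    rw [this, intervalIntegral.integral_const, smul_zero]
  have hDg_eZ : ∀ y, fderiv ℝ g y eZ = 0 := fun y => by
    have h1 : HasDerivAt (fun t : ℝ => g (y + t • eZ)) (fderiv ℝ g (y + (0 : ℝ) • eZ) eZ) 0 :=
      hasDerivAt_comp_add_smul_eZ hgd y 0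
    have h2 : (fun t : ℝ => g (y + t • eZ)) = fun _ => g y := funext fun t => hgz y t
    rw [h2, zero_smul, add_zero] at h1
    exact h1.unique (hasDerivAt_const (0 : ℝ) (g y))
  -- `⟪x_h, g⟫` is rotation-invariant (here the hypothesis on `u^r` enters)
  have hurax : IsAxisymmetricScalar fun y => ⟪horizPart y, U y⟫ := fun θ y => by
    show ⟪horizPart (rotZ θ y), U (rotZ θ y)⟫ = ⟪horizPart y, U y⟫
    rw [inner_horizPart_eq_cylRadius_mul_radialVelocity, inner_horizPart_eq_cylRadius_mul_radialVelocity,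
      cylRadius_rotZ, hrad θ y]
  have hrepr : ∀ y, ⟪horizPart y, g y⟫ = ∫ s in (0 : ℝ)..L, ⟪horizPart y, U (y + s • eZ)⟫ := by
    intro y
    show innerSL ℝ (horizPart y) (∫ s in (0 : ℝ)..L, U (y + s • eZ)) = _
    have hint : IntervalIntegrable (fun s : ℝ => U (y + s • eZ)) volume 0 L :=
      (hUc.comp (hline y)).intervalIntegrable _ _
    rw [← (innerSL ℝ (horizPart y)).intervalIntegral_comp_comm hint]
    simp only [innerSL_apply_apply]
  have hhax : IsAxisymmetricScalar fun y => ⟪horizPart y, g y⟫ := fun θ y => by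
    show ⟪horizPart (rotZ θ y), g (rotZ θ y)⟫ = ⟪horizPart y, g y⟫
    rw [hrepr, hrepr]
    refine intervalIntegral.integral_congr fun s _ => ?_
    show ⟪horizPart (rotZ θ y), U (rotZ θ y + s • eZ)⟫ = ⟪horizPart y, U (y + s • eZ)⟫
    have e1 : horizPart (rotZ θ y) = horizPart (rotZ θ (y + s • eZ)) := by
      rw [rotZ_add_smul_eZ, horizPart_add_smul_eZ]
    have e2 : horizPart y = horizPart (y + s • eZ) := by rw [horizPart_add_smul_eZ]
    rw [← rotZ_add_smul_eZ, e1, e2]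
    exact hurax θ (y + s • eZ)
  -- the angular mean `G = ⟨g⟩_θ`: axisymmetric, `C¹`, divergence free, `z`-independent
  set G : EuclideanSpace ℝ (Fin 3) → EuclideanSpace ℝ (Fin 3) := angularMeanVec g with hGdef
  have hG1 : ContDiff ℝ 1 G := contDiff_angularMeanVec (n := 1) hg1
  have hGd : Differentiable ℝ G := hG1.differentiable one_ne_zero
  have hGax : IsAxisymmetric G := isAxisymmetric_angularMeanVec g
  have hdivG : ∀ y, VectorCalculus.divergence G y = 0 := fun y => by
    have h1 := congrFun (angularMean_divergence hg1) y
    rw [← h1, show VectorCalculus.divergence g = fun _ => (0 : ℝ) from funext hdivg, angularMean_apply,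
      intervalIntegral.integral_const, smul_zero, smul_zero]
  have hrotZ_eZ : ∀ θ : ℝ, rotZ θ (eZ : EuclideanSpace ℝ (Fin 3)) = eZ := fun θ => by
    ext i; fin_cases i <;> simp [rotZ, eZ]
  have hGz : ∀ y, fderiv ℝ G y eZ = 0 := fun y => by
    rw [hGdef, fderiv_angularMeanVec_apply hg1 y eZ]
    have : (fun θ : ℝ => rotZ (-θ) (fderiv ℝ g (rotZ θ y) (rotZ θ eZ))) = fun _ => 0 := by
      funext θ
      rw [hrotZ_eZ, hDg_eZ]
      ext i; fin_cases i <;> simp [rotZ]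
    rw [this, intervalIntegral.integral_const, smul_zero, smul_zero]
  -- the core: `G` has no radial part
  have hGflux : ∀ y, ⟪horizPart y, G y⟫ = 0 :=
    inner_horizPart_eq_zero_of_isAxisymmetric_of_divergence_eq_zero hGd hdivG hGz hGax
  -- the radial part of `G` is that of `g`
  have hradg : IsAxisymmetricScalar (radialVelocity g) :=
    isAxisymmetricScalar_radialVelocity_of_inner_horizPart hhax
  have hGg : ⟪horizPart x, G x⟫ = ⟪horizPart x, g x⟫ := by
    rw [inner_horizPart_eq_cylRadius_mul_radialVelocity, inner_horizPart_eq_cylRadius_mul_radialVelocity]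
    congr 1
    rw [radialVelocity, hGdef, inner_angularMeanVec_eR hgc x, hradg.angularMean_eq]
  rw [← hrepr x, ← hGg]
  exact hGflux x

end Literature.Analysis.SteadySlabLiouville.PeriodicSlab

end Part4

/-!
## Part 5 — port of `Summits/NavierStokesRegularity/NavierStokesRegularity/Theorems/ScenarioCensusPeriodicSlabRadialLiouville.lean` (1 declarations kept)

# Census row S7, case (b): bounded periodic steady flows with axisymmetric radial velocity are
# axial constants (Bang–Gui–Wang–Xie 2025, Thm 1.4 (b))

Support file for the scenario census of `NavierStokesRegularity` (cell `pub/ns-census`, block S,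
row S7 = Bang–Gui–Wang–Xie, J. Fluid Mech. 1005 (2025) A6 = arXiv:2205.13259, Thm 1.4; tree FACT
`Literature.Analysis.FluidPDE.BangGuiWangXie2025_periodicSlab_liouville`, first conjunct, second
disjunct). **Theorem** (`periodicSlab_liouville_radialAxisymmetric`): for `ν > 0`, `L > 0`, a
smooth steady Navier–Stokes flow `(U, P)` on `ℝ³` (`IsLerayProfile ν 0 U P`, `U, P ∈ C^∞`),
bounded, axially `L`-periodic, whose radial velocity `u^r = radialVelocity U` is an axisymmetric
scalar ("`u^r` is independent of `θ`"), is an axial constant `U ≡ c e₃`.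

Proof: the radial velocity has zero vertical period means
(`radial_verticalMean_eq_zero_of_radialVelocity_axisymmetric`, BGWX §6 Step 2, through the
angular mean of the vertical period integral); hence `U` is constant
(`periodicSlab_liouville_of_radial_verticalMean`), and a constant field with axisymmetric `u^r` is
axial. No Bogovskiĭ map is used.

No summit statement is proved in this file; the census value of row S7 / a sub-row S7b is the
lead's call.

## References

* J. Bang, C. Gui, Y. Wang, C. Xie, arXiv:2205.13259, Thm 1.4 (b) and §6. [BangGuiWangXie2025]
-/

section Part5

open _root_.MeasureTheory _root_.Set _root_.Function _root_.Filter
open scoped _root_.Topology _root_.InnerProductSpace RealInnerProductSpace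

namespace Literature.Analysis.SteadySlabLiouville.PeriodicSlab

open Literature.Analysis Literature.Analysis.FluidPDE
open Literature.Analysis.SteadySlabLiouville.HelicalSlab

/-- **Bang–Gui–Wang–Xie 2025, Thm 1.4 (b).** Let `ν > 0`, `L > 0`, and let `(U, P)` be a smooth
steady solution of the unforced Navier–Stokes system on `ℝ³` (`IsLerayProfile ν 0 U P`,
`U, P ∈ C^∞`), bounded and axially `L`-periodic, whose radial velocity `radialVelocity U = u^r` is
an axisymmetric scalar. Then `U ≡ c e₃` for some real `c`.
[cite: BangGuiWangXie2025, Thm 1.4 (b), proof §5 (source of the ARGUMENT this module implements; this declaration is the cell’s own lemma or plumbing, NOT a printed statement)] -/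
theorem periodicSlab_liouville_radialAxisymmetric {ν L : ℝ} (hν : 0 < ν) (hL : 0 < L)
    {U : EuclideanSpace ℝ (Fin 3) → EuclideanSpace ℝ (Fin 3)} {P : EuclideanSpace ℝ (Fin 3) → ℝ}
    (hprof : IsLerayProfile ν 0 U P) (hU : ContDiff ℝ (⊤ : ℕ∞) U) (hP : ContDiff ℝ (⊤ : ℕ∞) P)
    (hbd : ∃ M : ℝ, ∀ x, ‖U x‖ ≤ M) (hper : IsAxiallyPeriodic L U)
    (hrad : IsAxisymmetricScalar (radialVelocity U)) :
    ∃ c : ℝ, U = fun _ => c • eZ := by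
  obtain ⟨M, hM⟩ := hbd
  have hst : IsSteadyClassicalNS ν 0 U P := isSteadyClassicalNS_of_isLerayProfile hprof hU hP
  obtain ⟨K₁, K₂, K₃, -, -, -, hK⟩ := steady_derivative_bounds hν hst hM
  have hU1 : ContDiff ℝ 1 U := contDiff_infty.1 hU 1
  have hmean := radial_verticalMean_eq_zero_of_radialVelocity_axisymmetric hU1 (fun x => (hK x).1)
    hst.divFree hper hrad
  obtain ⟨C, hC⟩ := periodicSlab_liouville_of_radial_verticalMean hν hL hprof hU hP ⟨M, hM⟩ hper hmean
  -- the constant has axisymmetric radial velocity, hence no horizontal part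
  have hinv : ∀ θ x, ⟪horizPart (rotZ θ x), C⟫ = ⟪horizPart x, C⟫ := fun θ x => by
    have h1 := inner_horizPart_eq_cylRadius_mul_radialVelocity U (rotZ θ x)
    have h2 := inner_horizPart_eq_cylRadius_mul_radialVelocity U x
    rw [cylRadius_rotZ, hrad θ x, ← h2] at h1
    simpa [hC] using h1
  have h1 := hinv Real.pi (EuclideanSpace.single 0 1)
  have h2 := hinv Real.pi (EuclideanSpace.single 1 1)
  simp [inner_horizPart_left, Real.cos_pi, Real.sin_pi] at h1 h2
  refine ⟨C 2, ?_⟩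
  rw [hC]
  funext x
  ext i
  fin_cases i <;> simp [eZ] <;> linarith

end Literature.Analysis.SteadySlabLiouville.PeriodicSlab

end Part5

/-!
## Part 6 — port of `Summits/NavierStokesRegularity/NavierStokesRegularity/Theorems/ScenarioCensusPeriodicSlabStream.lean` (9 declarations kept)

# Census row S7 (c): the stream potential of a planar divergence-free field (homotopy formula)

Support file for the scenario census of `NavierStokesRegularity` (cell `pub/ns-census`, block S,
row S7 = Bang–Gui–Wang–Xie, J. Fluid Mech. 1005 (2025) A6 = arXiv:2205.13259, Thm 1.4; tree FACT
`Literature.Analysis.FluidPDE.BangGuiWangXie2025_periodicSlab_liouville`). Case (c) of the printed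
theorem ("`r u^r` converges to `0` as `r → +∞`", §5 Step 3) bounds the cut-off pressure term
`∫ P u^r φ_R'` through a Bogovskiĭ corrector `Ψ_R` with `div Ψ_R = r u^r` on the annular period
cell (printed Lemma 2.1). In the tree the corrector is built EXPLICITLY from the stream function
of the vertical period mean `g = ∫₀ᴸ U(· + s e₃) ds` of the velocity (a planar divergence-free
field). This file supplies the planar potential by the homotopy (Poincaré-lemma) formula

  `f(x) = ∫₀¹ ⟪J g(t x_h), x_h⟫ dt`,  `J = rotGen`, `x_h = horizPart x`,

and proves, for a `C¹` field `g` with bounded `g`, `Dg` and vanishing horizontal trace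
`∂₀g₀ + ∂₁g₁ = 0`:

* `hasFDerivAt_streamPotential` — `Df(x) v = ⟪J g(x_h), v⟫` (`∇f = J g`; differentiation under
  the integral, the symmetry `⟪J Dg v_h, x_h⟫ = ⟪J Dg x_h, v_h⟫` of trace-free horizontal blocks,
  and the fundamental theorem of calculus for `t ↦ t g(t x_h)`);
* `abs_streamPotential_sub_le_of_circle` — oscillation on circles: if `|⟪y_h, g y⟫| ≤ N` on the
  horizontal circle of radius `ρ = r(x) > 0`, then `|f(x) − f(ρ e₀)| ≤ π N` (polar angle via
  `Complex.arg`, angular path `θ ↦ f(R_θ (ρ e₀))` whose speed is the radial flux).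

Sequel: `…PeriodicSlabStreamCorrector` (the bounded corrector potential `f − f(√(1+r²) e₀)`).
No summit statement and no census row is proved in this file.

## References

* J. Bang, C. Gui, Y. Wang, C. Xie, arXiv:2205.13259, §5 Step 3 (proof of Thm 1.4 (c)) and
  Lemma 2.1 (the Bogovskiĭ map). [BangGuiWangXie2025]

Not carried from this source module (not needed by the declarations re-homed here; their consumers are Summits-side): `fderiv_streamPotential`.
-/

section Part6

open _root_.MeasureTheory _root_.Set _root_.Function _root_.Filter _root_.InnerProductSpace
open scoped _root_.Topology RealInnerProductSpace Interval

namespace Literature.Analysis.SteadySlabLiouville.PeriodicSlab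

open Literature.Analysis Literature.Analysis.FluidPDE
/-! ### Plumbing for the generator `J = rotGen` -/

/-- `⟪J a, J x⟫ = ⟪x_h, a⟫`: the generator is an isometry on horizontal parts.
[cite: BangGuiWangXie2025, Thm 1.4 (c), proof §5 (§2: the Bogovskiĭ-type corrector) (source of the ARGUMENT this module implements; this declaration is the cell’s own lemma or plumbing, NOT a printed statement)] -/
theorem inner_rotGen_rotGen (a x : EuclideanSpace ℝ (Fin 3)) :
    ⟪rotGen a, rotGen x⟫ = ⟪horizPart x, a⟫ := by
  rw [inner_rotGen_left, inner_horizPart_left]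
  simp only [rotGen_apply_zero, rotGen_apply_one]
  ring

/-- `⟪J a, v_h⟫ = ⟪J a, v⟫`: the generator is horizontal.
[cite: BangGuiWangXie2025, Thm 1.4 (c), proof §5 (§2: the Bogovskiĭ-type corrector) (source of the ARGUMENT this module implements; this declaration is the cell’s own lemma or plumbing, NOT a printed statement)] -/
theorem inner_rotGen_horizPart (a v : EuclideanSpace ℝ (Fin 3)) :
    ⟪rotGen a, horizPart v⟫ = ⟪rotGen a, v⟫ := by
  rw [inner_rotGen_left, inner_rotGen_left, horizPart_apply_zero, horizPart_apply_one]

/-- `r(c e₀) = |c|`.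
[cite: BangGuiWangXie2025, Thm 1.4 (c), proof §5 (§2: the Bogovskiĭ-type corrector) (source of the ARGUMENT this module implements; this declaration is the cell’s own lemma or plumbing, NOT a printed statement)] -/
theorem cylRadius_smul_single_zero (c : ℝ) :
    cylRadius (c • EuclideanSpace.single 0 (1 : ℝ) : EuclideanSpace ℝ (Fin 3)) = |c| := by
  rw [cylRadius, ← Real.sqrt_sq_eq_abs]
  congr 1
  simp

/-- `J (x_h) = J x`.
[cite: BangGuiWangXie2025, Thm 1.4 (c), proof §5 (§2: the Bogovskiĭ-type corrector) (source of the ARGUMENT this module implements; this declaration is the cell’s own lemma or plumbing, NOT a printed statement)] -/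
theorem rotGen_horizPart (x : EuclideanSpace ℝ (Fin 3)) : rotGen (horizPart x) = rotGen x := by
  ext i
  fin_cases i <;> simp [rotGen]

/-- The velocity of the rotation orbit is the generator at the current point:
`d/dθ R_θ x = J (R_θ x)`.
[cite: BangGuiWangXie2025, Thm 1.4 (c), proof §5 (§2: the Bogovskiĭ-type corrector) (source of the ARGUMENT this module implements; this declaration is the cell’s own lemma or plumbing, NOT a printed statement)] -/
theorem hasDerivAt_rotZ_rotGen (x : EuclideanSpace ℝ (Fin 3)) (θ₀ : ℝ) :
    HasDerivAt (fun θ => rotZ θ x) (rotGen (rotZ θ₀ x)) θ₀ := by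
  have h := hasDerivAt_rotZ x θ₀
  have e : -Real.sin θ₀ • (WithLp.toLp 2 ![x 0, x 1, 0] : EuclideanSpace ℝ (Fin 3)) +
      Real.cos θ₀ • rotGen x = rotGen (rotZ θ₀ x) := by
    ext i
    fin_cases i <;> simp [rotGen] <;> ring
  rwa [e] at h

/-- **Symmetry of the planar pairing for trace-free horizontal blocks.** If the horizontal trace
of `G` vanishes, `G e₀ · e₀ + G e₁ · e₁ = 0`, then `⟪J (G v_h), x_h⟫ = ⟪J (G x_h), v_h⟫`
(closedness of the 1-form `⟪J g, dx⟫` for a planar divergence-free `g`).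
[cite: BangGuiWangXie2025, Thm 1.4 (c), proof §5 (§2: the Bogovskiĭ-type corrector) (source of the ARGUMENT this module implements; this declaration is the cell’s own lemma or plumbing, NOT a printed statement)] -/
theorem inner_rotGen_apply_horizPart_symm (G : EuclideanSpace ℝ (Fin 3) →L[ℝ] EuclideanSpace ℝ (Fin 3))
    (hG : G (EuclideanSpace.single 0 1) 0 + G (EuclideanSpace.single 1 1) 1 = 0)
    (x v : EuclideanSpace ℝ (Fin 3)) :
    ⟪rotGen (G (horizPart v)), horizPart x⟫ = ⟪rotGen (G (horizPart x)), horizPart v⟫ := by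
  have hv : horizPart v = v 0 • EuclideanSpace.single 0 (1 : ℝ) + v 1 • EuclideanSpace.single 1 (1 : ℝ) := by
    rw [horizPart_eq_toLp]; ext i; fin_cases i <;> simp
  have hx : horizPart x = x 0 • EuclideanSpace.single 0 (1 : ℝ) + x 1 • EuclideanSpace.single 1 (1 : ℝ) := by
    rw [horizPart_eq_toLp]; ext i; fin_cases i <;> simp
  rw [inner_rotGen_left, inner_rotGen_left]
  conv_lhs => rw [hv]
  conv_rhs => rw [hx]
  rw [hx, hv]
  simp only [map_add, map_smul, PiLp.add_apply, PiLp.smul_apply, smul_eq_mul,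
    PiLp.single_apply]
  simp only [Fin.isValue, ↓reduceIte, one_ne_zero, zero_ne_one, mul_one, mul_zero, add_zero, zero_add]
  linear_combination (x 1 * v 0 - x 0 * v 1) * hG

/-! ### The stream potential -/

/-- **The stream potential** of a planar field `g` (homotopy formula of the Poincaré lemma for
the closed 1-form `⟪J g, dx⟫`): `f(x) = ∫₀¹ ⟪J g(t x_h), x_h⟫ dt`. It depends on `x` only
through `x_h`.
[cite: BangGuiWangXie2025, Thm 1.4 (c), proof §5 (§2: the Bogovskiĭ-type corrector) (source of the ARGUMENT this module implements; this declaration is the cell’s own lemma or plumbing, NOT a printed statement)] -/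
def streamPotential (g : EuclideanSpace ℝ (Fin 3) → EuclideanSpace ℝ (Fin 3))
    (x : EuclideanSpace ℝ (Fin 3)) : ℝ :=
  ∫ t in (0 : ℝ)..1, ⟪rotGen (g (t • horizPart x)), horizPart x⟫

/-- **The gradient of the stream potential is `J g`.** Let `g` be differentiable with
derivative `Dg`, `Dg` continuous, `‖g‖ ≤ G₀`, `‖Dg‖ ≤ K`, and with vanishing horizontal trace
`Dg(y) e₀ · e₀ + Dg(y) e₁ · e₁ = 0` at every point. Then `f = streamPotential g` has
`Df(x) v = ⟪J g(x_h), v⟫`.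
[cite: BangGuiWangXie2025, Thm 1.4 (c), proof §5 (§2: the Bogovskiĭ-type corrector) (source of the ARGUMENT this module implements; this declaration is the cell’s own lemma or plumbing, NOT a printed statement)] -/
theorem hasFDerivAt_streamPotential {g : EuclideanSpace ℝ (Fin 3) → EuclideanSpace ℝ (Fin 3)}
    {Dg : EuclideanSpace ℝ (Fin 3) → (EuclideanSpace ℝ (Fin 3) →L[ℝ] EuclideanSpace ℝ (Fin 3))}
    (hg : ∀ y, HasFDerivAt g (Dg y) y) (hDgc : Continuous Dg) {G₀ K : ℝ}
    (hG₀ : ∀ y, ‖g y‖ ≤ G₀) (hK : ∀ y, ‖Dg y‖ ≤ K)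
    (htr : ∀ y, Dg y (EuclideanSpace.single 0 1) 0 + Dg y (EuclideanSpace.single 1 1) 1 = 0)
    (x₀ : EuclideanSpace ℝ (Fin 3)) :
    HasFDerivAt (streamPotential g) (innerSL ℝ (rotGen (g (horizPart x₀)))) x₀ := by
  have nrot : ∀ w : EuclideanSpace ℝ (Fin 3), ‖rotGen w‖ ≤ ‖w‖ := fun w => by
    have h1 : ‖rotGen w‖ ^ 2 ≤ ‖w‖ ^ 2 := by
      rw [EuclideanSpace.real_norm_sq_eq, EuclideanSpace.real_norm_sq_eq]
      simp only [Fin.sum_univ_three, rotGen_apply_zero, rotGen_apply_one, rotGen_apply_two]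
      nlinarith [sq_nonneg (w 2)]
    exact (pow_le_pow_iff_left₀ (norm_nonneg _) (norm_nonneg _) two_ne_zero).1 h1
  have ncyl : ∀ w : EuclideanSpace ℝ (Fin 3), cylRadius w ≤ ‖w‖ := fun w => by
    rw [← norm_horizPart]
    have h1 : ‖horizPart w‖ ^ 2 ≤ ‖w‖ ^ 2 := by
      rw [norm_horizPart_sq, EuclideanSpace.real_norm_sq_eq]
      simp only [Fin.sum_univ_three]
      nlinarith [sq_nonneg (w 2), Real.norm_eq_abs (w 2), sq_abs (w 2)]
    exact (pow_le_pow_iff_left₀ (norm_nonneg _) (norm_nonneg _) two_ne_zero).1 h1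
  have hgc : Continuous g := continuous_iff_continuousAt.2 fun y => (hg y).continuousAt
  have hG₀0 : 0 ≤ G₀ := (norm_nonneg _).trans (hG₀ 0)
  have hK0 : 0 ≤ K := (norm_nonneg _).trans (hK 0)
  -- the integrand and its derivative in `x`
  set F : EuclideanSpace ℝ (Fin 3) → ℝ → ℝ := fun x t => ⟪rotGen (g (t • horizPart x)), horizPart x⟫ with hF
  set F' : EuclideanSpace ℝ (Fin 3) → ℝ → (EuclideanSpace ℝ (Fin 3) →L[ℝ] ℝ) := fun x t =>
    (innerSL ℝ (horizPart x)).comp (rotGenL.comp ((t • Dg (t • horizPart x)).comp horizPart)) +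
      innerSL ℝ (rotGen (g (t • horizPart x))) with hF'
  have hF'_apply : ∀ x t v, F' x t v =
      t * ⟪rotGen (Dg (t • horizPart x) (horizPart v)), horizPart x⟫ +
        ⟪rotGen (g (t • horizPart x)), v⟫ := by
    intro x t v
    simp only [hF', _root_.add_apply, ContinuousLinearMap.comp_apply,
      innerSL_apply_apply, rotGenL_apply, FunLike.coe_smul, Pi.smul_apply, rotGen_smul,
      real_inner_comm (horizPart x)]
    rw [real_inner_smul_right]
  -- pointwise differentiability of the integrand
  have hdiff : ∀ t x, HasFDerivAt (fun y => F y t) (F' x t) x := by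
    intro t x
    have h1 : HasFDerivAt (fun y : EuclideanSpace ℝ (Fin 3) => t • horizPart y) (t • horizPart) x :=
      (horizPart.hasFDerivAt).const_smul t
    have h2 : HasFDerivAt (fun y => g (t • horizPart y)) ((Dg (t • horizPart x)).comp (t • horizPart)) x :=
      (hg (t • horizPart x)).comp x h1
    have h3 : HasFDerivAt (fun y => rotGen (g (t • horizPart y)))
        (rotGenL.comp ((Dg (t • horizPart x)).comp (t • horizPart))) x :=
      (hasFDerivAt_rotGen _).comp x h2
    refine (h3.inner ℝ (horizPart.hasFDerivAt (x := x))).congr_fderiv ?_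
    ext v
    simp only [hF', fderivInnerCLM_apply, ContinuousLinearMap.comp_apply, ContinuousLinearMap.prod_apply,
      _root_.add_apply, innerSL_apply_apply, rotGenL_apply, FunLike.coe_smul,
      Pi.smul_apply, map_smul, inner_rotGen_horizPart]
    rw [add_comm, real_inner_comm (horizPart x), real_inner_smul_right, smul_eq_mul]
  -- continuity in `t`
  have hline : ∀ x : EuclideanSpace ℝ (Fin 3), Continuous fun t : ℝ => t • horizPart x :=
    fun x => continuous_id.smul continuous_const
  have hFc : ∀ x, Continuous (F x) := fun x =>
    ((rotGenL.continuous.comp (hgc.comp (hline x)))).inner continuous_const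
  have hF'c : ∀ x, Continuous (F' x) := by
    intro x
    refine Continuous.add ?_ ?_
    · refine (continuous_const.clm_comp (continuous_const.clm_comp ?_))
      exact (continuous_id.smul (hDgc.comp (hline x))).clm_comp continuous_const
    · exact (innerSL ℝ).continuous.comp (rotGenL.continuous.comp (hgc.comp (hline x)))
  -- the bound on the ball of radius one
  have hbound : ∀ t ∈ Ι (0 : ℝ) 1, ∀ x ∈ Metric.ball x₀ 1, ‖F' x t‖ ≤ (‖x₀‖ + 1) * K + G₀ := by
    intro t ht x hx
    have ht' : 0 ≤ t ∧ t ≤ 1 := by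
      rw [Set.uIoc_of_le zero_le_one] at ht; exact ⟨ht.1.le, ht.2⟩
    have hxn : ‖x‖ ≤ ‖x₀‖ + 1 := by
      have := mem_ball_iff_norm.1 hx
      calc ‖x‖ = ‖(x - x₀) + x₀‖ := by rw [sub_add_cancel]
        _ ≤ ‖x - x₀‖ + ‖x₀‖ := norm_add_le _ _
        _ ≤ ‖x₀‖ + 1 := by linarith
    have hxh : ‖horizPart x‖ ≤ ‖x‖ := by
      rw [norm_horizPart]; exact ncyl x
    refine ContinuousLinearMap.opNorm_le_bound _ (by positivity) fun v => ?_
    rw [hF'_apply, Real.norm_eq_abs]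
    have hvh : ‖horizPart v‖ ≤ ‖v‖ := by rw [norm_horizPart]; exact ncyl v
    have e1 : |t * ⟪rotGen (Dg (t • horizPart x) (horizPart v)), horizPart x⟫| ≤ (‖x₀‖ + 1) * K * ‖v‖ := by
      rw [abs_mul, abs_of_nonneg ht'.1]
      have h1 : |⟪rotGen (Dg (t • horizPart x) (horizPart v)), horizPart x⟫| ≤ K * ‖v‖ * ‖x‖ := by
        calc |⟪rotGen (Dg (t • horizPart x) (horizPart v)), horizPart x⟫|
            ≤ ‖rotGen (Dg (t • horizPart x) (horizPart v))‖ * ‖horizPart x‖ := abs_real_inner_le_norm _ _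
          _ ≤ ‖Dg (t • horizPart x) (horizPart v)‖ * ‖x‖ :=
              mul_le_mul (nrot _) hxh (norm_nonneg _) (norm_nonneg _)
          _ ≤ (‖Dg (t • horizPart x)‖ * ‖horizPart v‖) * ‖x‖ :=
              mul_le_mul_of_nonneg_right (ContinuousLinearMap.le_opNorm _ _) (norm_nonneg _)
          _ ≤ (K * ‖v‖) * ‖x‖ := mul_le_mul_of_nonneg_right
              (mul_le_mul (hK _) hvh (norm_nonneg _) hK0) (norm_nonneg _)
      calc t * |⟪rotGen (Dg (t • horizPart x) (horizPart v)), horizPart x⟫| ≤ 1 * (K * ‖v‖ * ‖x‖) :=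
            mul_le_mul ht'.2 h1 (abs_nonneg _) zero_le_one
        _ ≤ (‖x₀‖ + 1) * K * ‖v‖ := by
            rw [one_mul]
            calc K * ‖v‖ * ‖x‖ ≤ K * ‖v‖ * (‖x₀‖ + 1) :=
                  mul_le_mul_of_nonneg_left hxn (mul_nonneg hK0 (norm_nonneg _))
              _ = (‖x₀‖ + 1) * K * ‖v‖ := by ring
    have e2 : |⟪rotGen (g (t • horizPart x)), v⟫| ≤ G₀ * ‖v‖ := by
      calc |⟪rotGen (g (t • horizPart x)), v⟫| ≤ ‖rotGen (g (t • horizPart x))‖ * ‖v‖ := abs_real_inner_le_norm _ _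
        _ ≤ G₀ * ‖v‖ := mul_le_mul_of_nonneg_right ((nrot _).trans (hG₀ _)) (norm_nonneg _)
    calc |t * ⟪rotGen (Dg (t • horizPart x) (horizPart v)), horizPart x⟫ + ⟪rotGen (g (t • horizPart x)), v⟫|
        ≤ |t * ⟪rotGen (Dg (t • horizPart x) (horizPart v)), horizPart x⟫| + |⟪rotGen (g (t • horizPart x)), v⟫| :=
          abs_add_le _ _
      _ ≤ (‖x₀‖ + 1) * K * ‖v‖ + G₀ * ‖v‖ := add_le_add e1 e2
      _ = ((‖x₀‖ + 1) * K + G₀) * ‖v‖ := by ring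
  -- differentiation under the integral
  have hmain : HasFDerivAt (streamPotential g) (∫ t in (0 : ℝ)..1, F' x₀ t) x₀ := by
    refine intervalIntegral.hasFDerivAt_integral_of_dominated_of_fderiv_le (𝕜 := ℝ) (μ := volume)
      (F := F) (F' := F') (x₀ := x₀) (s := Metric.ball x₀ 1) (bound := fun _ => (‖x₀‖ + 1) * K + G₀)
      (Metric.ball_mem_nhds x₀ one_pos) ?_ ?_ ?_ ?_ ?_ ?_
    · exact Eventually.of_forall fun x => (hFc x).aestronglyMeasurable
    · exact (hFc x₀).intervalIntegrable _ _
    · exact (hF'c x₀).aestronglyMeasurable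
    · exact Eventually.of_forall fun t ht x hx => hbound t ht x hx
    · exact intervalIntegrable_const
    · exact Eventually.of_forall fun t _ x _ => hdiff t x
  -- evaluation of the derivative: symmetry and the fundamental theorem of calculus
  have hint : IntervalIntegrable (F' x₀) volume 0 1 := (hF'c x₀).intervalIntegrable _ _
  have heval : (∫ t in (0 : ℝ)..1, F' x₀ t) = innerSL ℝ (rotGen (g (horizPart x₀))) := by
    ext v
    rw [ContinuousLinearMap.intervalIntegral_apply hint v, innerSL_apply_apply]
    -- the path `k(t) = t • g(t x_h)` and its derivative
    set xh := horizPart x₀ with hxh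
    set k : ℝ → EuclideanSpace ℝ (Fin 3) := fun t => t • g (t • xh) with hk
    set k' : ℝ → EuclideanSpace ℝ (Fin 3) := fun t => g (t • xh) + t • Dg (t • xh) xh with hk'
    have hkd : ∀ t, HasDerivAt k (k' t) t := by
      intro t
      have h1 : HasDerivAt (fun s : ℝ => s • xh) xh t := by
        simpa using (hasDerivAt_id t).smul_const xh
      have h2 : HasDerivAt (fun s : ℝ => g (s • xh)) (Dg (t • xh) xh) t :=
        (hg (t • xh)).comp_hasDerivAt t h1
      have h3 := (hasDerivAt_id' t).smul h2
      have h4 : k' t = t • Dg (t • xh) xh + (1 : ℝ) • g (t • xh) := by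
        simp only [hk', one_smul, add_comm]
      rw [h4]
      exact h3
    have hk'c : Continuous k' :=
      (hgc.comp (continuous_id.smul continuous_const)).add
        (continuous_id.smul ((hDgc.comp (continuous_id.smul continuous_const)).clm_apply continuous_const))
    have hftc : ∫ t in (0 : ℝ)..1, k' t = k 1 - k 0 :=
      intervalIntegral.integral_eq_sub_of_hasDerivAt (fun t _ => hkd t) (hk'c.intervalIntegrable _ _)
    have hk10 : k 1 - k 0 = g xh := by simp [hk]
    -- rewrite the integrand using the symmetry of the planar pairing
    have hsymm : ∀ t, F' x₀ t v = ⟪rotGen (k' t), v⟫ := by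
      intro t
      rw [hF'_apply, hk']
      have hs := inner_rotGen_apply_horizPart_symm (Dg (t • xh)) (htr _) x₀ v
      rw [← hxh] at hs
      rw [hs, inner_rotGen_horizPart, rotGen_add, rotGen_smul, inner_add_left, real_inner_smul_left]
      ring
    have hcont : Continuous fun t => ⟪rotGen (k' t), v⟫ :=
      (rotGenL.continuous.comp hk'c).inner continuous_const
    calc ∫ t in (0 : ℝ)..1, F' x₀ t v = ∫ t in (0 : ℝ)..1, ⟪rotGen (k' t), v⟫ :=
          intervalIntegral.integral_congr fun t _ => hsymm t
      _ = ⟪rotGen (∫ t in (0 : ℝ)..1, k' t), v⟫ := by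
          have hT : ∀ w, ((innerSL ℝ v).comp rotGenL) w = ⟪rotGen w, v⟫ := fun w => by
            rw [ContinuousLinearMap.comp_apply, rotGenL_apply, innerSL_apply_apply, real_inner_comm]
          rw [← hT, ← ((innerSL ℝ v).comp rotGenL).intervalIntegral_comp_comm (hk'c.intervalIntegrable _ _)]
          exact intervalIntegral.integral_congr fun t _ => (hT _).symm
      _ = ⟪rotGen (g xh), v⟫ := by rw [hftc, hk10]
  rwa [heval] at hmain

/-- **Oscillation of the stream potential on circles.** Under the hypotheses of
`hasFDerivAt_streamPotential`, if `|⟪y_h, g y⟫| ≤ N` at every HORIZONTAL point `y` of the circle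
of radius `ρ = r(x) > 0` (`y = y_h`, `r(y) = ρ`), then `|f(x) − f(ρ e₀)| ≤ π N`.
[cite: BangGuiWangXie2025, Thm 1.4 (c), proof §5 (§2: the Bogovskiĭ-type corrector) (source of the ARGUMENT this module implements; this declaration is the cell’s own lemma or plumbing, NOT a printed statement)] -/
theorem abs_streamPotential_sub_le_of_circle {g : EuclideanSpace ℝ (Fin 3) → EuclideanSpace ℝ (Fin 3)}
    {Dg : EuclideanSpace ℝ (Fin 3) → (EuclideanSpace ℝ (Fin 3) →L[ℝ] EuclideanSpace ℝ (Fin 3))}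
    (hg : ∀ y, HasFDerivAt g (Dg y) y) (hDgc : Continuous Dg) {G₀ K : ℝ}
    (hG₀ : ∀ y, ‖g y‖ ≤ G₀) (hK : ∀ y, ‖Dg y‖ ≤ K)
    (htr : ∀ y, Dg y (EuclideanSpace.single 0 1) 0 + Dg y (EuclideanSpace.single 1 1) 1 = 0)
    {x : EuclideanSpace ℝ (Fin 3)} (hx : 0 < cylRadius x) {N : ℝ}
    (hN : ∀ y : EuclideanSpace ℝ (Fin 3), horizPart y = y → cylRadius y = cylRadius x →
      |⟪horizPart y, g y⟫| ≤ N) :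
    |streamPotential g x - streamPotential g (cylRadius x • EuclideanSpace.single 0 1)| ≤ Real.pi * N := by
  set ρ := cylRadius x with hρ
  set e₀ : EuclideanSpace ℝ (Fin 3) := EuclideanSpace.single 0 1 with he₀
  set p : EuclideanSpace ℝ (Fin 3) := ρ • e₀ with hp
  set f := streamPotential g with hf
  have hN0 : 0 ≤ N := by
    have h := hN p ?_ ?_
    · exact (abs_nonneg _).trans h
    · rw [hp, map_smul]; congr 1; rw [he₀, horizPart_eq_toLp]; ext i; fin_cases i <;> simp
    · rw [hp, he₀, cylRadius_smul_single_zero, abs_of_pos hx]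
  -- the polar angle of `x_h`
  set z : ℂ := ⟨x 0, x 1⟩ with hz
  have hzn : ‖z‖ = ρ := by
    rw [hρ, cylRadius, Complex.norm_def, Complex.normSq_apply]
    congr 1; simp [hz]; ring
  have hz0 : z ≠ 0 := by
    intro h; rw [h, norm_zero] at hzn; exact absurd hzn.symm hx.ne'
  set θ : ℝ := Complex.arg z with hθ
  have hcos : ρ * Real.cos θ = x 0 := by
    rw [hθ, Complex.cos_arg hz0, hzn]; field_simp [hx.ne']; simp [hz]
  have hsin : ρ * Real.sin θ = x 1 := by
    rw [hθ, Complex.sin_arg, hzn]; field_simp [hx.ne']; simp [hz]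
  have hθπ : |θ| ≤ Real.pi := Complex.abs_arg_le_pi z
  have hrot : rotZ θ p = horizPart x := by
    rw [horizPart_eq_toLp]
    ext i
    fin_cases i <;> simp [rotZ, hp, he₀] <;> linarith [hcos, hsin]
  -- `f` only sees the horizontal part
  have hfh : ∀ y, f (horizPart y) = f y := fun y => by
    simp only [hf, streamPotential, horizPart_horizPart]
  -- the angular path
  set h : ℝ → ℝ := fun s => f (rotZ s p) with hh
  have hfd : ∀ y, HasFDerivAt f (innerSL ℝ (rotGen (g (horizPart y)))) y :=
    hasFDerivAt_streamPotential hg hDgc hG₀ hK htr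
  have hhd : ∀ s, HasDerivAt h ⟪horizPart (rotZ s p), g (rotZ s p)⟫ s := by
    intro s
    have h1 := (hfd (rotZ s p)).comp_hasDerivAt s (hasDerivAt_rotZ_rotGen p s)
    have hph : horizPart (rotZ s p) = rotZ s p := by
      rw [horizPart_eq_toLp]; ext i; fin_cases i <;> simp [rotZ, hp, he₀]
    have e : innerSL ℝ (rotGen (g (horizPart (rotZ s p)))) (rotGen (rotZ s p)) =
        ⟪horizPart (rotZ s p), g (rotZ s p)⟫ := by
      rw [innerSL_apply_apply, inner_rotGen_rotGen, hph]
    rw [e] at h1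
    exact h1
  have hderiv_le : ∀ s, ‖deriv h s‖ ≤ N := by
    intro s
    rw [(hhd s).deriv, Real.norm_eq_abs]
    refine hN (rotZ s p) ?_ ?_
    · rw [horizPart_eq_toLp]; ext i; fin_cases i <;> simp [rotZ, hp, he₀]
    · rw [cylRadius_rotZ, hp, he₀, cylRadius_smul_single_zero, abs_of_pos hx]
  have hmv : ‖h θ - h 0‖ ≤ N * ‖θ - 0‖ :=
    (convex_univ).norm_image_sub_le_of_norm_deriv_le (fun s _ => (hhd s).differentiableAt)
      (fun s _ => hderiv_le s) (mem_univ 0) (mem_univ θ)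
  rw [sub_zero, Real.norm_eq_abs, Real.norm_eq_abs] at hmv
  have hh0 : h 0 = f p := by simp [hh]
  have hhθ : h θ = f x := by
    show f (rotZ θ p) = f x
    rw [hrot, hfh]
  rw [hhθ, hh0] at hmv
  calc |f x - f p| ≤ N * |θ| := hmv
    _ ≤ N * Real.pi := mul_le_mul_of_nonneg_left hθπ hN0
    _ = Real.pi * N := mul_comm _ _

end Literature.Analysis.SteadySlabLiouville.PeriodicSlab

end Part6

/-!
## Part 7 — port of `Summits/NavierStokesRegularity/NavierStokesRegularity/Theorems/ScenarioCensusPeriodicSlabStreamCorrector.lean` (8 declarations kept)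

# Census row S7 (c): the bounded corrector potential `Φ̃ = f − f(√(1 + r²) e₀)`

Support file for the scenario census of `NavierStokesRegularity` (cell `pub/ns-census`, block S,
row S7 = Bang–Gui–Wang–Xie, J. Fluid Mech. 1005 (2025) A6 = arXiv:2205.13259, Thm 1.4 (c)).
The stream potential `f = streamPotential g` of `…PeriodicSlabStream` grows linearly; subtracting
its value at the smooth radial reference point `√(1 + r²) e₀` gives a `C¹` potential `Φ̃` with the
SAME angular derivative (the radial flux `⟪x_h, g(x_h)⟫`), gradient `‖DΦ̃‖ ≤ 2 sup ‖g‖`, and size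
`|Φ̃(x)| ≤ π N + sup ‖g‖` on every circle where the radial flux is bounded by `N`
(`abs_streamCorrector_le`). In the proof of Thm 1.4 (c) this replaces the `H¹₀` bound (4-15) of
the printed Bogovskiĭ corrector: the tree's corrector is `Ψ = Φ̃ J∇φ` (sequel
`…PeriodicSlabCorrector`).

No summit statement and no census row is proved in this file.

## References

* J. Bang, C. Gui, Y. Wang, C. Xie, arXiv:2205.13259, §5 Step 3 (proof of Thm 1.4 (c)).
  [BangGuiWangXie2025]
-/

section Part7

open _root_.MeasureTheory _root_.Set _root_.Function _root_.Filter _root_.InnerProductSpace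
open scoped _root_.Topology RealInnerProductSpace Interval

namespace Literature.Analysis.SteadySlabLiouville.PeriodicSlab

open Literature.Analysis Literature.Analysis.FluidPDE
/-! ### The corrector potential `Φ̃ = f − f(√(1 + r²) e₀)` -/

/-- The smooth radial reference radius `s(x) = √(1 + r(x)²)` (≥ 1, smooth everywhere).
[cite: BangGuiWangXie2025, Thm 1.4 (c), proof §5 (§2: the Bogovskiĭ-type corrector) (source of the ARGUMENT this module implements; this declaration is the cell’s own lemma or plumbing, NOT a printed statement)] -/
def refRadius (x : EuclideanSpace ℝ (Fin 3)) : ℝ := Real.sqrt (1 + ‖horizPart x‖ ^ 2)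

/-- `s(x) = √(1 + r²)` is positive.
[cite: BangGuiWangXie2025, Thm 1.4 (c), proof §5 (§2: the Bogovskiĭ-type corrector) (source of the ARGUMENT this module implements; this declaration is the cell’s own lemma or plumbing, NOT a printed statement)] -/
theorem refRadius_pos (x : EuclideanSpace ℝ (Fin 3)) : 0 < refRadius x :=
  Real.sqrt_pos.2 (by positivity)

/-- `r ≤ s(x) ≤ r + 1`.
[cite: BangGuiWangXie2025, Thm 1.4 (c), proof §5 (§2: the Bogovskiĭ-type corrector) (source of the ARGUMENT this module implements; this declaration is the cell’s own lemma or plumbing, NOT a printed statement)] -/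
theorem cylRadius_le_refRadius (x : EuclideanSpace ℝ (Fin 3)) :
    cylRadius x ≤ refRadius x ∧ refRadius x ≤ cylRadius x + 1 := by
  rw [refRadius, norm_horizPart]
  have h0 := cylRadius_nonneg x
  constructor
  · calc cylRadius x = Real.sqrt (cylRadius x ^ 2) := (Real.sqrt_sq h0).symm
      _ ≤ Real.sqrt (1 + cylRadius x ^ 2) := Real.sqrt_le_sqrt (by linarith)
  · rw [Real.sqrt_le_left (by linarith)]
    nlinarith

/-- The derivative of `s(x) = √(1 + ‖x_h‖²)`: `Ds(x) v = ⟪x_h, v⟫ / s(x)`.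
[cite: BangGuiWangXie2025, Thm 1.4 (c), proof §5 (§2: the Bogovskiĭ-type corrector) (source of the ARGUMENT this module implements; this declaration is the cell’s own lemma or plumbing, NOT a printed statement)] -/
theorem hasFDerivAt_refRadius (x : EuclideanSpace ℝ (Fin 3)) :
    HasFDerivAt refRadius ((refRadius x)⁻¹ • innerSL ℝ (horizPart x)) x := by
  have h1 : HasFDerivAt (fun y : EuclideanSpace ℝ (Fin 3) => 1 + ‖horizPart y‖ ^ 2)
      (2 • (innerSL ℝ (horizPart x)).comp horizPart) x := by
    have h := ((hasFDerivAt_id (horizPart x)).norm_sq).comp x horizPart.hasFDerivAt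
    have h' : HasFDerivAt (fun y : EuclideanSpace ℝ (Fin 3) => ‖horizPart y‖ ^ 2)
        (2 • (innerSL ℝ (horizPart x)).comp horizPart) x := by
      refine h.congr_fderiv ?_
      ext v
      simp [ContinuousLinearMap.comp_apply, innerSL_apply_apply]
    simpa using h'.const_add 1
  have hpos : 1 + ‖horizPart x‖ ^ 2 ≠ 0 := by positivity
  have h2 := h1.sqrt hpos
  refine h2.congr_fderiv ?_
  ext v
  simp only [refRadius, _root_.smul_apply, ContinuousLinearMap.comp_apply,
    innerSL_apply_apply, inner_horizPart_horizPart, smul_eq_mul]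
  field_simp
  ring

/-- **The corrector potential** `Φ̃(x) = f(x) − f(s(x) e₀)`, `f = streamPotential g`,
`s(x) = √(1 + r²)`: the stream potential minus its value at a smooth radial reference point.
[cite: BangGuiWangXie2025, Thm 1.4 (c), proof §5 (§2: the Bogovskiĭ-type corrector) (source of the ARGUMENT this module implements; this declaration is the cell’s own lemma or plumbing, NOT a printed statement)] -/
def streamCorrector (g : EuclideanSpace ℝ (Fin 3) → EuclideanSpace ℝ (Fin 3))
    (x : EuclideanSpace ℝ (Fin 3)) : ℝ :=
  streamPotential g x - streamPotential g (refRadius x • EuclideanSpace.single 0 1)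

/-- **Derivative of the corrector potential**:
`DΦ̃(x) v = ⟪J g(x_h), v⟫ − ⟪J g(s e₀), e₀⟫ ⟪x_h, v⟫ / s`.
[cite: BangGuiWangXie2025, Thm 1.4 (c), proof §5 (§2: the Bogovskiĭ-type corrector) (source of the ARGUMENT this module implements; this declaration is the cell’s own lemma or plumbing, NOT a printed statement)] -/
theorem hasFDerivAt_streamCorrector {g : EuclideanSpace ℝ (Fin 3) → EuclideanSpace ℝ (Fin 3)}
    {Dg : EuclideanSpace ℝ (Fin 3) → (EuclideanSpace ℝ (Fin 3) →L[ℝ] EuclideanSpace ℝ (Fin 3))}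
    (hg : ∀ y, HasFDerivAt g (Dg y) y) (hDgc : Continuous Dg) {G₀ K : ℝ}
    (hG₀ : ∀ y, ‖g y‖ ≤ G₀) (hK : ∀ y, ‖Dg y‖ ≤ K)
    (htr : ∀ y, Dg y (EuclideanSpace.single 0 1) 0 + Dg y (EuclideanSpace.single 1 1) 1 = 0)
    (x : EuclideanSpace ℝ (Fin 3)) :
    HasFDerivAt (streamCorrector g)
      (innerSL ℝ (rotGen (g (horizPart x))) -
        (⟪rotGen (g (horizPart (refRadius x • EuclideanSpace.single 0 (1 : ℝ)))),
            (EuclideanSpace.single 0 (1 : ℝ) : EuclideanSpace ℝ (Fin 3))⟫ * (refRadius x)⁻¹) •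
          innerSL ℝ (horizPart x)) x := by
  set e₀ : EuclideanSpace ℝ (Fin 3) := EuclideanSpace.single 0 1 with he₀
  have hf := hasFDerivAt_streamPotential hg hDgc hG₀ hK htr
  have h1 := (hasFDerivAt_refRadius x).smul_const e₀
  have h2 := (hf (refRadius x • e₀)).comp x h1
  refine ((hf x).sub h2).congr_fderiv ?_
  ext v
  simp only [_root_.sub_apply, ContinuousLinearMap.comp_apply,
    ContinuousLinearMap.smulRight_apply, _root_.smul_apply, innerSL_apply_apply,
    smul_eq_mul, real_inner_smul_right]
  ring

/-- **Properties of the corrector potential.** Under the hypotheses of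
`hasFDerivAt_streamPotential` (`‖g‖ ≤ G₀`): `Φ̃ = streamCorrector g` is differentiable,
`‖DΦ̃(x)‖ ≤ 2 G₀`, its angular derivative is the radial flux `DΦ̃(x)[J x] = ⟪x_h, g(x_h)⟫`, and
its derivative is continuous.
[cite: BangGuiWangXie2025, Thm 1.4 (c), proof §5 (§2: the Bogovskiĭ-type corrector) (source of the ARGUMENT this module implements; this declaration is the cell’s own lemma or plumbing, NOT a printed statement)] -/
theorem streamCorrector_deriv {g : EuclideanSpace ℝ (Fin 3) → EuclideanSpace ℝ (Fin 3)}
    {Dg : EuclideanSpace ℝ (Fin 3) → (EuclideanSpace ℝ (Fin 3) →L[ℝ] EuclideanSpace ℝ (Fin 3))}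
    (hg : ∀ y, HasFDerivAt g (Dg y) y) (hDgc : Continuous Dg) {G₀ K : ℝ}
    (hG₀ : ∀ y, ‖g y‖ ≤ G₀) (hK : ∀ y, ‖Dg y‖ ≤ K)
    (htr : ∀ y, Dg y (EuclideanSpace.single 0 1) 0 + Dg y (EuclideanSpace.single 1 1) 1 = 0) :
    Differentiable ℝ (streamCorrector g) ∧ Continuous (fderiv ℝ (streamCorrector g)) ∧
      (∀ x, ‖fderiv ℝ (streamCorrector g) x‖ ≤ 2 * G₀) ∧
      ∀ x, fderiv ℝ (streamCorrector g) x (rotGen x) = ⟪horizPart x, g (horizPart x)⟫ := by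
  have nrot : ∀ w : EuclideanSpace ℝ (Fin 3), ‖rotGen w‖ ≤ ‖w‖ := fun w => by
    have h1 : ‖rotGen w‖ ^ 2 ≤ ‖w‖ ^ 2 := by
      rw [EuclideanSpace.real_norm_sq_eq, EuclideanSpace.real_norm_sq_eq]
      simp only [Fin.sum_univ_three, rotGen_apply_zero, rotGen_apply_one, rotGen_apply_two]
      nlinarith [sq_nonneg (w 2)]
    exact (pow_le_pow_iff_left₀ (norm_nonneg _) (norm_nonneg _) two_ne_zero).1 h1
  set e₀ : EuclideanSpace ℝ (Fin 3) := EuclideanSpace.single 0 1 with he₀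
  have hgc : Continuous g := continuous_iff_continuousAt.2 fun y => (hg y).continuousAt
  have hG₀0 : 0 ≤ G₀ := (norm_nonneg _).trans (hG₀ 0)
  have hD := hasFDerivAt_streamCorrector hg hDgc hG₀ hK htr
  have hfd : ∀ x, fderiv ℝ (streamCorrector g) x = innerSL ℝ (rotGen (g (horizPart x))) -
      (⟪rotGen (g (horizPart (refRadius x • e₀))), e₀⟫ * (refRadius x)⁻¹) • innerSL ℝ (horizPart x) :=
    fun x => (hD x).fderiv
  have he₀n : ‖e₀‖ = 1 := by simp [he₀]
  refine ⟨fun x => (hD x).differentiableAt, ?_, fun x => ?_, fun x => ?_⟩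
  · -- continuity of the derivative
    have hc : Continuous fun x => innerSL ℝ (rotGen (g (horizPart x))) -
        (⟪rotGen (g (horizPart (refRadius x • e₀))), e₀⟫ * (refRadius x)⁻¹) • innerSL ℝ (horizPart x) := by
      have hs : Continuous refRadius := continuous_iff_continuousAt.2 fun y =>
        (hasFDerivAt_refRadius y).continuousAt
      refine ((innerSL ℝ).continuous.comp (rotGenL.continuous.comp (hgc.comp horizPart.continuous))).sub ?_
      have hsc : Continuous fun x => ⟪rotGen (g (horizPart (refRadius x • e₀))), e₀⟫ * (refRadius x)⁻¹ := by
        refine Continuous.mul ?_ (hs.inv₀ fun y => (refRadius_pos y).ne')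
        exact ((rotGenL.continuous.comp (hgc.comp (horizPart.continuous.comp
          (hs.smul continuous_const)))).inner continuous_const)
      exact hsc.smul ((innerSL ℝ).continuous.comp horizPart.continuous)
    exact hc.congr fun x => (hfd x).symm
  · -- the bound `‖DΦ̃‖ ≤ 2 G₀`
    rw [hfd x]
    have hs0 := refRadius_pos x
    have h1 : ‖innerSL ℝ (rotGen (g (horizPart x)))‖ ≤ G₀ := by
      rw [innerSL_apply_norm]; exact (nrot _).trans (hG₀ _)
    have h2 : ‖(⟪rotGen (g (horizPart (refRadius x • e₀))), e₀⟫ * (refRadius x)⁻¹) •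
        innerSL ℝ (horizPart x)‖ ≤ G₀ := by
      rw [norm_smul, innerSL_apply_norm, norm_mul, Real.norm_eq_abs, Real.norm_eq_abs,
        abs_inv, abs_of_pos hs0, norm_horizPart]
      have h3 : |⟪rotGen (g (horizPart (refRadius x • e₀))), e₀⟫| ≤ G₀ := by
        calc |⟪rotGen (g (horizPart (refRadius x • e₀))), e₀⟫|
            ≤ ‖rotGen (g (horizPart (refRadius x • e₀)))‖ * ‖e₀‖ := abs_real_inner_le_norm _ _
          _ ≤ G₀ := by rw [he₀n, mul_one]; exact (nrot _).trans (hG₀ _)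
      have h4 : (refRadius x)⁻¹ * cylRadius x ≤ 1 := by
        rw [inv_mul_le_iff₀ hs0, mul_one]; exact (cylRadius_le_refRadius x).1
      calc |⟪rotGen (g (horizPart (refRadius x • e₀))), e₀⟫| * (refRadius x)⁻¹ * cylRadius x
          = |⟪rotGen (g (horizPart (refRadius x • e₀))), e₀⟫| * ((refRadius x)⁻¹ * cylRadius x) := by ring
        _ ≤ G₀ * 1 := mul_le_mul h3 h4 (mul_nonneg (inv_nonneg.2 hs0.le) (cylRadius_nonneg x)) hG₀0
        _ = G₀ := mul_one _
    exact (norm_sub_le _ _).trans (by linarith)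
  · -- the angular derivative
    rw [hfd x]
    simp only [_root_.sub_apply, _root_.smul_apply, innerSL_apply_apply,
      smul_eq_mul]
    rw [inner_rotGen_rotGen, ← rotGen_horizPart x, ← real_inner_comm (horizPart x) (rotGen (horizPart x)),
      inner_rotGen_self, mul_zero, sub_zero]

/-- **Size of the corrector potential on circles.** Under the hypotheses of
`hasFDerivAt_streamPotential`: if `r(x) > 0` and `|⟪y_h, g y⟫| ≤ N` at the horizontal points of
the circle of radius `r(x)`, then `|Φ̃(x)| ≤ π N + G₀`.
[cite: BangGuiWangXie2025, Thm 1.4 (c), proof §5 (§2: the Bogovskiĭ-type corrector) (source of the ARGUMENT this module implements; this declaration is the cell’s own lemma or plumbing, NOT a printed statement)] -/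
theorem abs_streamCorrector_le {g : EuclideanSpace ℝ (Fin 3) → EuclideanSpace ℝ (Fin 3)}
    {Dg : EuclideanSpace ℝ (Fin 3) → (EuclideanSpace ℝ (Fin 3) →L[ℝ] EuclideanSpace ℝ (Fin 3))}
    (hg : ∀ y, HasFDerivAt g (Dg y) y) (hDgc : Continuous Dg) {G₀ K : ℝ}
    (hG₀ : ∀ y, ‖g y‖ ≤ G₀) (hK : ∀ y, ‖Dg y‖ ≤ K)
    (htr : ∀ y, Dg y (EuclideanSpace.single 0 1) 0 + Dg y (EuclideanSpace.single 1 1) 1 = 0)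
    {x : EuclideanSpace ℝ (Fin 3)} (hx : 0 < cylRadius x) {N : ℝ}
    (hN : ∀ y : EuclideanSpace ℝ (Fin 3), horizPart y = y → cylRadius y = cylRadius x →
      |⟪horizPart y, g y⟫| ≤ N) :
    |streamCorrector g x| ≤ Real.pi * N + G₀ := by
  have nrot : ∀ w : EuclideanSpace ℝ (Fin 3), ‖rotGen w‖ ≤ ‖w‖ := fun w => by
    have h1 : ‖rotGen w‖ ^ 2 ≤ ‖w‖ ^ 2 := by
      rw [EuclideanSpace.real_norm_sq_eq, EuclideanSpace.real_norm_sq_eq]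
      simp only [Fin.sum_univ_three, rotGen_apply_zero, rotGen_apply_one, rotGen_apply_two]
      nlinarith [sq_nonneg (w 2)]
    exact (pow_le_pow_iff_left₀ (norm_nonneg _) (norm_nonneg _) two_ne_zero).1 h1
  set e₀ : EuclideanSpace ℝ (Fin 3) := EuclideanSpace.single 0 1 with he₀
  set f := streamPotential g with hf
  have hG₀0 : 0 ≤ G₀ := (norm_nonneg _).trans (hG₀ 0)
  have h1 : |f x - f (cylRadius x • e₀)| ≤ Real.pi * N :=
    abs_streamPotential_sub_le_of_circle hg hDgc hG₀ hK htr hx hN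
  -- along the ray from `r e₀` to `s e₀`
  have hfd : ∀ y, HasFDerivAt f (innerSL ℝ (rotGen (g (horizPart y)))) y :=
    hasFDerivAt_streamPotential hg hDgc hG₀ hK htr
  set q : ℝ → ℝ := fun τ => f (τ • e₀) with hq
  have hqd : ∀ τ, HasDerivAt q ⟪rotGen (g (horizPart (τ • e₀))), e₀⟫ τ := by
    intro τ
    have hl : HasDerivAt (fun σ : ℝ => σ • e₀) e₀ τ := by simpa using (hasDerivAt_id τ).smul_const e₀
    have h := (hfd (τ • e₀)).comp_hasDerivAt τ hl
    rw [innerSL_apply_apply] at h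
    exact h
  have he₀n : ‖e₀‖ = 1 := by simp [he₀]
  have hqb : ∀ τ, ‖deriv q τ‖ ≤ G₀ := fun τ => by
    rw [(hqd τ).deriv, Real.norm_eq_abs]
    calc |⟪rotGen (g (horizPart (τ • e₀))), e₀⟫| ≤ ‖rotGen (g (horizPart (τ • e₀)))‖ * ‖e₀‖ :=
          abs_real_inner_le_norm _ _
      _ ≤ G₀ := by rw [he₀n, mul_one]; exact (nrot _).trans (hG₀ _)
  have h2 : ‖q (refRadius x) - q (cylRadius x)‖ ≤ G₀ * ‖refRadius x - cylRadius x‖ :=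
    (convex_univ).norm_image_sub_le_of_norm_deriv_le (fun τ _ => (hqd τ).differentiableAt)
      (fun τ _ => hqb τ) (mem_univ _) (mem_univ _)
  have h3 : ‖refRadius x - cylRadius x‖ ≤ 1 := by
    have h := cylRadius_le_refRadius x
    rw [Real.norm_eq_abs, abs_of_nonneg (by linarith [h.1])]; linarith [h.2]
  have h4 : |q (refRadius x) - q (cylRadius x)| ≤ G₀ := by
    rw [← Real.norm_eq_abs]
    exact h2.trans ((mul_le_mul_of_nonneg_left h3 hG₀0).trans (by rw [mul_one]))
  have e : streamCorrector g x = (f x - f (cylRadius x • e₀)) - (q (refRadius x) - q (cylRadius x)) := by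
    simp only [streamCorrector, hq, hf, he₀]; ring
  rw [e]
  calc |(f x - f (cylRadius x • e₀)) - (q (refRadius x) - q (cylRadius x))|
      ≤ |f x - f (cylRadius x • e₀)| + |q (refRadius x) - q (cylRadius x)| := abs_sub _ _
    _ ≤ Real.pi * N + G₀ := add_le_add h1 h4

end Literature.Analysis.SteadySlabLiouville.PeriodicSlab

end Part7

/-!
## Part 8 — port of `Summits/NavierStokesRegularity/NavierStokesRegularity/Theorems/ScenarioCensusPeriodicSlabCutoffCoeff.lean` (14 declarations kept)

# Census row S7 (c): the coefficient of the dyadic cylindrical cut-off and the rotation field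
# `J∇φ`, with second-derivative bounds

Support file for the scenario census of `NavierStokesRegularity` (cell `pub/ns-census`, block S,
row S7 = Bang–Gui–Wang–Xie, J. Fluid Mech. 1005 (2025) A6 = arXiv:2205.13259, Thm 1.4 (c)). The
tree's corrector for case (c) is `Ψ = Φ̃ · J∇φ` with `φ = cylCutoff r (2r)` the dyadic cut-off and
`J = rotGen`; its derivative involves the HESSIAN of the cut-off, which the tree's cut-off files
(`CylindricalCutoff`, `LeiZhang2011Cutoff`: gradient bounds only) do not provide; the bounds on
`Θ'`, `Θ''` (`Θ = Real.smoothTransition`) are the tree's (`SmoothCutoff`, `Wei2016HardyCutoff`). Here: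

* `dyCoeff r` — the explicit coefficient `a` with `Dφ(x) v = a(x) ⟪x_h, v⟫`
  (`fderiv_cylCutoff_two_mul`), smooth, axisymmetric, `z`-invariant, with
  `|a| ≤ C/r² · χ` and `‖Da‖ ≤ C/r³ · χ`, `χ = 𝟙{r ≤ ρ < 2r}` (`exists_dyCoeff_bounds`);
* `corrField r x = a(x) • J x = J ∇φ(x)` — smooth, `z`-invariant, divergence free
  (`divergence_corrField`), with `‖W‖ ≤ 2C/r · χ`, `‖DW‖ ≤ 3C/r² · χ` (`exists_corrField_bounds`).

No summit statement and no census row is proved in this file.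

## References

* J. Bang, C. Gui, Y. Wang, C. Xie, arXiv:2205.13259, §5 Step 3 (proof of Thm 1.4 (c)).
  [BangGuiWangXie2025]
* Z. Lei, Q. S. Zhang, arXiv:1011.5066, §2 (2.1) (the radial cut-offs). [LeiZhang2011]

Not carried from this source module (not needed by the declarations re-homed here; their consumers are Summits-side): `isAxiallyPeriodic_corrField`.
-/

section Part8

open _root_.MeasureTheory _root_.Set _root_.Function _root_.Filter _root_.InnerProductSpace
open scoped _root_.Topology RealInnerProductSpace

namespace Literature.Analysis.SteadySlabLiouville.PeriodicSlab

open Literature.Analysis Literature.Analysis.FluidPDE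

/-! ### The coefficient of the dyadic cut-off `φ = cylCutoff r (2r)` -/

/-- The argument of the profile in the dyadic cut-off: `c ((2r)² − ‖x_h‖²)`,
`c = ((2r)² − r²)⁻¹`.
[cite: BangGuiWangXie2025, Thm 1.4 (c), proof §5 (§2: the Bogovskiĭ-type corrector) (source of the ARGUMENT this module implements; this declaration is the cell’s own lemma or plumbing, NOT a printed statement)] -/
def dyArg (r : ℝ) (x : EuclideanSpace ℝ (Fin 3)) : ℝ :=
  ((2 * r) ^ 2 - r ^ 2)⁻¹ * ((2 * r) ^ 2 - ‖horizPart x‖ ^ 2)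

/-- **The coefficient of the gradient of the dyadic cut-off**, `∇φ(x) = a(x) x_h`:
`a(x) = Θ'(c((2r)² − ‖x_h‖²)) · (−2c)`.
[cite: BangGuiWangXie2025, Thm 1.4 (c), proof §5 (§2: the Bogovskiĭ-type corrector) (source of the ARGUMENT this module implements; this declaration is the cell’s own lemma or plumbing, NOT a printed statement)] -/
def dyCoeff (r : ℝ) (x : EuclideanSpace ℝ (Fin 3)) : ℝ :=
  deriv Real.smoothTransition (dyArg r x) * (((2 * r) ^ 2 - r ^ 2)⁻¹ * (-2))

/-- `Dφ(x) v = a(x) ⟪x_h, v⟫` for the dyadic cut-off `φ = cylCutoff r (2r)`.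
[cite: BangGuiWangXie2025, Thm 1.4 (c), proof §5 (§2: the Bogovskiĭ-type corrector) (source of the ARGUMENT this module implements; this declaration is the cell’s own lemma or plumbing, NOT a printed statement)] -/
theorem fderiv_cylCutoff_two_mul (r : ℝ) (x v : EuclideanSpace ℝ (Fin 3)) :
    fderiv ℝ (cylCutoff r (2 * r)) x v = dyCoeff r x * ⟪horizPart x, v⟫ := by
  rw [fderiv_cylCutoff, (LeiZhang2011.hasFDerivAt_radialCutoff r (2 * r) (horizPart x)).fderiv]
  simp only [FunLike.coe_smul, Pi.smul_apply, _root_.neg_apply, innerSL_apply_apply, smul_eq_mul,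
    dyCoeff, dyArg]
  ring

/-- `a` is smooth.
[cite: BangGuiWangXie2025, Thm 1.4 (c), proof §5 (§2: the Bogovskiĭ-type corrector) (source of the ARGUMENT this module implements; this declaration is the cell’s own lemma or plumbing, NOT a printed statement)] -/
theorem contDiff_dyCoeff (r : ℝ) {n : ℕ∞} : ContDiff ℝ n (dyCoeff r) := by
  refine (Wei2016.contDiff_deriv_smoothTransition.comp ?_).mul contDiff_const
  exact contDiff_const.mul (contDiff_const.sub ((contDiff_norm_sq ℝ).comp horizPart.contDiff))

/-- `a` is invariant under axial translations.
[cite: BangGuiWangXie2025, Thm 1.4 (c), proof §5 (§2: the Bogovskiĭ-type corrector) (source of the ARGUMENT this module implements; this declaration is the cell’s own lemma or plumbing, NOT a printed statement)] -/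
theorem dyCoeff_add_smul_eZ (r : ℝ) (x : EuclideanSpace ℝ (Fin 3)) (t : ℝ) :
    dyCoeff r (x + t • eZ) = dyCoeff r x := by
  simp only [dyCoeff, dyArg, horizPart_add_smul_eZ]

/-- `a` is axisymmetric.
[cite: BangGuiWangXie2025, Thm 1.4 (c), proof §5 (§2: the Bogovskiĭ-type corrector) (source of the ARGUMENT this module implements; this declaration is the cell’s own lemma or plumbing, NOT a printed statement)] -/
theorem isAxisymmetricScalar_dyCoeff (r : ℝ) : IsAxisymmetricScalar (dyCoeff r) := fun θ x => by
  simp only [dyCoeff, dyArg, horizPart_rotZ, norm_rotZ]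

/-- The derivative of `a`: `Da(x) v = 4c² Θ''(arg) ⟪x_h, v⟫`.
[cite: BangGuiWangXie2025, Thm 1.4 (c), proof §5 (§2: the Bogovskiĭ-type corrector) (source of the ARGUMENT this module implements; this declaration is the cell’s own lemma or plumbing, NOT a printed statement)] -/
theorem hasFDerivAt_dyCoeff (r : ℝ) (x : EuclideanSpace ℝ (Fin 3)) :
    HasFDerivAt (dyCoeff r)
      ((deriv (deriv Real.smoothTransition) (dyArg r x) *
          ((((2 * r) ^ 2 - r ^ 2)⁻¹ * (-2)) * (((2 * r) ^ 2 - r ^ 2)⁻¹ * (-2)))) •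
        innerSL ℝ (horizPart x)) x := by
  set c : ℝ := ((2 * r) ^ 2 - r ^ 2)⁻¹ with hc
  have h1 : HasFDerivAt (fun y : EuclideanSpace ℝ (Fin 3) => ‖horizPart y‖ ^ 2)
      ((2 : ℝ) • (innerSL ℝ (horizPart x)).comp horizPart) x := by
    have h := ((hasFDerivAt_id (horizPart x)).norm_sq).comp x horizPart.hasFDerivAt
    refine h.congr_fderiv ?_
    ext v
    simp [ContinuousLinearMap.comp_apply, innerSL_apply_apply]
  have h2 : HasFDerivAt (dyArg r) (c • (-((2 : ℝ) • (innerSL ℝ (horizPart x)).comp horizPart))) x := by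
    show HasFDerivAt (fun y : EuclideanSpace ℝ (Fin 3) => c * ((2 * r) ^ 2 - ‖horizPart y‖ ^ 2)) _ x
    exact (h1.const_sub ((2 * r) ^ 2)).const_mul c
  have hT : HasDerivAt (deriv Real.smoothTransition) (deriv (deriv Real.smoothTransition) (dyArg r x))
      (dyArg r x) :=
    (Wei2016.differentiable_deriv_smoothTransition _).hasDerivAt
  have h3 := (hT.comp_hasFDerivAt x h2).mul_const (c * (-2))
  refine h3.congr_fderiv ?_
  ext v
  simp only [_root_.smul_apply, _root_.neg_apply, ContinuousLinearMap.comp_apply, innerSL_apply_apply,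
    inner_horizPart_horizPart, smul_eq_mul, hc]
  ring

/-- **Bounds for the coefficient.** There is an absolute `C ≥ 0` such that for every `r > 0`,
with `χ = 𝟙{r ≤ ρ < 2r}`: `|a(x)| ≤ (C/r²) χ(x)` and `‖Da(x)‖ ≤ (C/r³) χ(x)` for all `x` (in
particular `a` and `Da` vanish off the annulus).
[cite: BangGuiWangXie2025, Thm 1.4 (c), proof §5 (§2: the Bogovskiĭ-type corrector) (source of the ARGUMENT this module implements; this declaration is the cell’s own lemma or plumbing, NOT a printed statement)] -/
theorem exists_dyCoeff_bounds :
    ∃ C : ℝ, 0 ≤ C ∧ ∀ r : ℝ, 0 < r →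
      (∀ x, |dyCoeff r x| ≤
          C / r ^ 2 * {x | r ≤ cylRadius x ∧ cylRadius x < 2 * r}.indicator (fun _ => (1 : ℝ)) x) ∧
      ∀ x, ‖fderiv ℝ (dyCoeff r) x‖ ≤
          C / r ^ 3 * {x | r ≤ cylRadius x ∧ cylRadius x < 2 * r}.indicator (fun _ => (1 : ℝ)) x := by
  obtain ⟨C₁, hC₁0, hC₁⟩ := LeiZhang2011.exists_abs_deriv_smoothTransition_le
  obtain ⟨C₂, hC₂0, hC₂⟩ := Carleman.exists_bound_deriv_deriv_smoothTransition
  refine ⟨C₁ + C₂, by positivity, fun r hr => ?_⟩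
  set A : Set (EuclideanSpace ℝ (Fin 3)) := {x | r ≤ cylRadius x ∧ cylRadius x < 2 * r} with hA
  set χ : EuclideanSpace ℝ (Fin 3) → ℝ := A.indicator fun _ => (1 : ℝ) with hχ
  have hc : ((2 * r) ^ 2 - r ^ 2)⁻¹ = (3 * r ^ 2)⁻¹ := by ring_nf
  have hc0 : 0 < (3 * r ^ 2)⁻¹ := by positivity
  -- the argument off the annulus
  have harg_out : ∀ x, 2 * r ≤ cylRadius x → dyArg r x ≤ 0 := fun x hx => by
    rw [dyArg, hc, norm_horizPart]
    have : (2 * r) ^ 2 - cylRadius x ^ 2 ≤ 0 := by nlinarith [cylRadius_nonneg x]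
    exact mul_nonpos_of_nonneg_of_nonpos hc0.le this
  have harg_in : ∀ x, cylRadius x < r → 1 ≤ dyArg r x := fun x hx => by
    rw [dyArg, hc, norm_horizPart]
    have h0 := cylRadius_nonneg x
    rw [le_inv_mul_iff₀ (by positivity : (0 : ℝ) < 3 * r ^ 2), mul_one]
    nlinarith
  have hzero : ∀ x, x ∉ A → deriv Real.smoothTransition (dyArg r x) = 0 ∧
      deriv (deriv Real.smoothTransition) (dyArg r x) = 0 := by
    intro x hx
    simp only [hA, mem_setOf_eq, not_and_or, not_le, not_lt] at hx
    rcases hx with hx | hx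
    · exact ⟨Literature.Analysis.Calculus.deriv_smoothTransition_of_one_le (harg_in x hx),
        Wei2016.deriv_deriv_smoothTransition_of_one_le (harg_in x hx)⟩
    · exact ⟨Literature.Analysis.Calculus.deriv_smoothTransition_of_nonpos (harg_out x hx),
        Wei2016.deriv_deriv_smoothTransition_of_nonpos (harg_out x hx)⟩
  constructor
  · intro x
    by_cases hx : x ∈ A
    · have hχ1 : χ x = 1 := by simp [hχ, hx]
      rw [hχ1, mul_one, dyCoeff, hc, abs_mul]
      calc |deriv Real.smoothTransition (dyArg r x)| * |(3 * r ^ 2)⁻¹ * -2|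
          ≤ C₁ * ((3 * r ^ 2)⁻¹ * 2) := by
            rw [abs_mul, abs_of_pos hc0, abs_neg, abs_two]
            exact mul_le_mul_of_nonneg_right (hC₁ _) (by positivity)
        _ ≤ (C₁ + C₂) / r ^ 2 := by
            rw [div_eq_mul_inv]
            have : (3 * r ^ 2)⁻¹ * 2 ≤ (r ^ 2)⁻¹ := by
              rw [mul_inv, mul_assoc, mul_comm _ (2 : ℝ), ← mul_assoc]; norm_num
              exact mul_le_of_le_one_left (by positivity) (by norm_num)
            calc C₁ * ((3 * r ^ 2)⁻¹ * 2) ≤ C₁ * (r ^ 2)⁻¹ := mul_le_mul_of_nonneg_left this hC₁0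
              _ ≤ (C₁ + C₂) * (r ^ 2)⁻¹ := mul_le_mul_of_nonneg_right (by linarith) (by positivity)
    · have hχ0 : χ x = 0 := by simp [hχ, hx]
      rw [hχ0, mul_zero, dyCoeff, (hzero x hx).1, zero_mul, abs_zero]
  · intro x
    rw [(hasFDerivAt_dyCoeff r x).fderiv]
    by_cases hx : x ∈ A
    · have hχ1 : χ x = 1 := by simp [hχ, hx]
      have hρ : cylRadius x < 2 * r := hx.2
      rw [hχ1, mul_one, norm_smul, innerSL_apply_norm, norm_horizPart, hc, Real.norm_eq_abs, abs_mul,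
        show |(3 * r ^ 2)⁻¹ * -2 * ((3 * r ^ 2)⁻¹ * -2)| = 4 * ((3 * r ^ 2)⁻¹) ^ 2 by
          rw [show (3 * r ^ 2)⁻¹ * -2 * ((3 * r ^ 2)⁻¹ * -2) = 4 * ((3 * r ^ 2)⁻¹) ^ 2 by ring]
          exact abs_of_nonneg (by positivity)]
      calc |deriv (deriv Real.smoothTransition) (dyArg r x)| * (4 * ((3 * r ^ 2)⁻¹) ^ 2) * cylRadius x
          ≤ C₂ * (4 * ((3 * r ^ 2)⁻¹) ^ 2) * (2 * r) :=
            mul_le_mul (mul_le_mul_of_nonneg_right (hC₂ _) (by positivity)) hρ.le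
              (cylRadius_nonneg x) (by positivity)
        _ = (8 / 9 * C₂) / r ^ 3 := by field_simp; ring
        _ ≤ (C₁ + C₂) / r ^ 3 := by
            refine div_le_div_of_nonneg_right ?_ (by positivity)
            nlinarith
    · have hχ0 : χ x = 0 := by simp [hχ, hx]
      rw [hχ0, mul_zero, (hzero x hx).2, zero_mul, zero_smul, norm_zero]

/-! ### The rotation field `W = a • J x = J ∇φ` -/

/-- **The rotation field of the dyadic cut-off**, `W(x) = a(x) J x = J ∇φ(x)` (horizontal,
tangent to circles about the axis, supported in the annulus `{r ≤ ρ < 2r}`).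
[cite: BangGuiWangXie2025, Thm 1.4 (c), proof §5 (§2: the Bogovskiĭ-type corrector) (source of the ARGUMENT this module implements; this declaration is the cell’s own lemma or plumbing, NOT a printed statement)] -/
def corrField (r : ℝ) (x : EuclideanSpace ℝ (Fin 3)) : EuclideanSpace ℝ (Fin 3) :=
  dyCoeff r x • rotGen x

/-- `W` is smooth.
[cite: BangGuiWangXie2025, Thm 1.4 (c), proof §5 (§2: the Bogovskiĭ-type corrector) (source of the ARGUMENT this module implements; this declaration is the cell’s own lemma or plumbing, NOT a printed statement)] -/
theorem contDiff_corrField (r : ℝ) {n : ℕ∞} : ContDiff ℝ n (corrField r) :=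
  (contDiff_dyCoeff r).smul rotGenL.contDiff

/-- `W` is invariant under axial translations.
[cite: BangGuiWangXie2025, Thm 1.4 (c), proof §5 (§2: the Bogovskiĭ-type corrector) (source of the ARGUMENT this module implements; this declaration is the cell’s own lemma or plumbing, NOT a printed statement)] -/
theorem corrField_add_smul_eZ (r : ℝ) (x : EuclideanSpace ℝ (Fin 3)) (t : ℝ) :
    corrField r (x + t • eZ) = corrField r x := by
  rw [corrField, corrField, dyCoeff_add_smul_eZ, rotGen_add_smul_eZ]

/-- The derivative of `W`: `DW(x) v = (Da(x) v) J x + a(x) J v`.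
[cite: BangGuiWangXie2025, Thm 1.4 (c), proof §5 (§2: the Bogovskiĭ-type corrector) (source of the ARGUMENT this module implements; this declaration is the cell’s own lemma or plumbing, NOT a printed statement)] -/
theorem hasFDerivAt_corrField (r : ℝ) (x : EuclideanSpace ℝ (Fin 3)) :
    HasFDerivAt (corrField r)
      ((fderiv ℝ (dyCoeff r) x).smulRight (rotGen x) + dyCoeff r x • rotGenL) x := by
  have h1 : HasFDerivAt (dyCoeff r) (fderiv ℝ (dyCoeff r) x) x :=
    ((contDiff_dyCoeff r (n := 1)).differentiable one_ne_zero x).hasFDerivAt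
  have h := h1.smul (hasFDerivAt_rotGen x)
  refine h.congr_fderiv ?_
  ext v
  simp [ContinuousLinearMap.smulRight_apply, add_comm]

/-- **Bounds for `W` and `DW`.** There is an absolute `C ≥ 0` such that for every `r > 0`, with
`χ = 𝟙{r ≤ ρ < 2r}`: `‖W(x)‖ ≤ (C/r) χ(x)` and `‖DW(x)‖ ≤ (C/r²) χ(x)` for all `x`; the same `C`
bounds the coefficient, `|a(x)| ≤ (C/r²) χ(x)`.
[cite: BangGuiWangXie2025, Thm 1.4 (c), proof §5 (§2: the Bogovskiĭ-type corrector) (source of the ARGUMENT this module implements; this declaration is the cell’s own lemma or plumbing, NOT a printed statement)] -/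
theorem exists_corrField_bounds :
    ∃ C : ℝ, 0 ≤ C ∧ ∀ r : ℝ, 0 < r →
      (∀ x, |dyCoeff r x| ≤
          C / r ^ 2 * {x | r ≤ cylRadius x ∧ cylRadius x < 2 * r}.indicator (fun _ => (1 : ℝ)) x) ∧
      (∀ x, ‖corrField r x‖ ≤
          C / r * {x | r ≤ cylRadius x ∧ cylRadius x < 2 * r}.indicator (fun _ => (1 : ℝ)) x) ∧
      ∀ x, ‖fderiv ℝ (corrField r) x‖ ≤
          C / r ^ 2 * {x | r ≤ cylRadius x ∧ cylRadius x < 2 * r}.indicator (fun _ => (1 : ℝ)) x := by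
  obtain ⟨C, hC0, hC⟩ := exists_dyCoeff_bounds
  have hJn : ∀ y : EuclideanSpace ℝ (Fin 3), ‖rotGen y‖ = cylRadius y := fun y => by
    rw [cylRadius, ← Real.sqrt_sq (norm_nonneg (rotGen y)), EuclideanSpace.real_norm_sq_eq]
    congr 1
    simp only [Fin.sum_univ_three, rotGen_apply_zero, rotGen_apply_one, rotGen_apply_two, neg_sq]
    nlinarith [Real.norm_eq_abs (y 0), Real.norm_eq_abs (y 1), sq_abs (y 0), sq_abs (y 1),
      Real.norm_eq_abs (0:ℝ)]
  refine ⟨3 * C, by positivity, fun r hr => ⟨fun x => ?_, fun x => ?_, fun x => ?_⟩⟩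
  · refine ((hC r hr).1 x).trans (mul_le_mul_of_nonneg_right ?_ (Set.indicator_nonneg (fun _ _ => zero_le_one) x))
    exact div_le_div_of_nonneg_right (by linarith) (by positivity)
  · set χ := {x | r ≤ cylRadius x ∧ cylRadius x < 2 * r}.indicator (fun _ => (1 : ℝ)) with hχ
    by_cases hx : x ∈ {x | r ≤ cylRadius x ∧ cylRadius x < 2 * r}
    · have hχ1 : χ x = 1 := by simp [hχ, hx]
      have h1 := (hC r hr).1 x
      rw [← hχ] at h1; rw [hχ1, mul_one] at h1 ⊢
      rw [corrField, norm_smul, Real.norm_eq_abs, hJn]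
      calc |dyCoeff r x| * cylRadius x ≤ C / r ^ 2 * (2 * r) :=
            mul_le_mul h1 hx.2.le (cylRadius_nonneg x) (by positivity)
        _ = 2 * C / r := by field_simp
        _ ≤ 3 * C / r := div_le_div_of_nonneg_right (by linarith) hr.le
    · have hχ0 : χ x = 0 := by simp [hχ, hx]
      have h1 := (hC r hr).1 x
      rw [← hχ] at h1; rw [hχ0, mul_zero] at h1 ⊢
      have : dyCoeff r x = 0 := abs_eq_zero.1 (le_antisymm h1 (abs_nonneg _))
      rw [corrField, this, zero_smul, norm_zero]
  · set χ := {x | r ≤ cylRadius x ∧ cylRadius x < 2 * r}.indicator (fun _ => (1 : ℝ)) with hχ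
    rw [(hasFDerivAt_corrField r x).fderiv]
    have hrotL : ‖(rotGenL : EuclideanSpace ℝ (Fin 3) →L[ℝ] EuclideanSpace ℝ (Fin 3))‖ ≤ 1 := by
      refine ContinuousLinearMap.opNorm_le_bound _ zero_le_one fun v => ?_
      rw [one_mul, rotGenL_apply, hJn, ← norm_horizPart]
      have h1 : ‖horizPart v‖ ^ 2 ≤ ‖v‖ ^ 2 := by
        rw [norm_horizPart_sq, EuclideanSpace.real_norm_sq_eq]
        simp only [Fin.sum_univ_three]
        nlinarith [sq_nonneg (v 2), Real.norm_eq_abs (v 2), sq_abs (v 2)]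
      exact (pow_le_pow_iff_left₀ (norm_nonneg _) (norm_nonneg _) two_ne_zero).1 h1
    by_cases hx : x ∈ {x | r ≤ cylRadius x ∧ cylRadius x < 2 * r}
    · have hχ1 : χ x = 1 := by simp [hχ, hx]
      have h1 := (hC r hr).1 x
      have h2 := (hC r hr).2 x
      rw [← hχ] at h1 h2; rw [hχ1, mul_one] at h1 h2 ⊢
      have e1 : ‖(fderiv ℝ (dyCoeff r) x).smulRight (rotGen x)‖ ≤ C / r ^ 3 * (2 * r) := by
        rw [ContinuousLinearMap.norm_smulRight_apply, hJn]
        exact mul_le_mul h2 hx.2.le (cylRadius_nonneg x) (by positivity)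
      have e2 : ‖dyCoeff r x • (rotGenL : EuclideanSpace ℝ (Fin 3) →L[ℝ] EuclideanSpace ℝ (Fin 3))‖ ≤
          C / r ^ 2 * 1 := by
        rw [norm_smul, Real.norm_eq_abs]
        exact mul_le_mul h1 hrotL (norm_nonneg _) (by positivity)
      calc ‖(fderiv ℝ (dyCoeff r) x).smulRight (rotGen x) + dyCoeff r x • rotGenL‖
          ≤ C / r ^ 3 * (2 * r) + C / r ^ 2 * 1 := (norm_add_le _ _).trans (add_le_add e1 e2)
        _ = 3 * C / r ^ 2 := by field_simp; ring
    · have hχ0 : χ x = 0 := by simp [hχ, hx]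
      have h1 := (hC r hr).1 x
      have h2 := (hC r hr).2 x
      rw [← hχ] at h1 h2; rw [hχ0, mul_zero] at h1 h2 ⊢
      have ha : dyCoeff r x = 0 := abs_eq_zero.1 (le_antisymm h1 (abs_nonneg _))
      have hDa : fderiv ℝ (dyCoeff r) x = 0 := norm_eq_zero.1 (le_antisymm h2 (norm_nonneg _))
      have e : (fderiv ℝ (dyCoeff r) x).smulRight (rotGen x) + dyCoeff r x • rotGenL = 0 := by
        rw [ha, hDa]; ext v; simp
      rw [e, norm_zero]

/-- **`W` is divergence free**: `div (a J x) = a div J + ⟪J x, ∇a⟫ = 0` (`J` is trace free and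
`a` is axisymmetric).
[cite: BangGuiWangXie2025, Thm 1.4 (c), proof §5 (§2: the Bogovskiĭ-type corrector) (source of the ARGUMENT this module implements; this declaration is the cell’s own lemma or plumbing, NOT a printed statement)] -/
theorem divergence_corrField (r : ℝ) (x : EuclideanSpace ℝ (Fin 3)) :
    VectorCalculus.divergence (corrField r) x = 0 := by
  have hdiff : DifferentiableAt ℝ (dyCoeff r) x := (contDiff_dyCoeff r (n := 1)).differentiable one_ne_zero x
  have h := divergence_smul_apply (u := rotGen) hdiff (hasFDerivAt_rotGen x).differentiableAt
  have hdivJ : VectorCalculus.divergence rotGen x = 0 := by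
    set b := EuclideanSpace.basisFun (Fin 3) ℝ with hb
    rw [divergence_eq_sum_inner_fderiv b, (hasFDerivAt_rotGen x).fderiv, Fin.sum_univ_three]
    have hb0 : b 0 = EuclideanSpace.single 0 (1 : ℝ) := by simp [hb]
    have hb1 : b 1 = EuclideanSpace.single 1 (1 : ℝ) := by simp [hb]
    have hb2 : b 2 = EuclideanSpace.single 2 (1 : ℝ) := by simp [hb]
    rw [hb0, hb1, hb2]
    simp only [rotGenL_apply, rotGen_single_zero, rotGen_single_one, rotGen_single_two, inner_neg_right,
      EuclideanSpace.inner_single_left, inner_zero_right]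
    simp
  have hax : ⟪rotGen x, gradient (dyCoeff r) x⟫ = 0 :=
    (isAxisymmetricScalar_dyCoeff r).inner_rotGen_gradient hdiff
  show VectorCalculus.divergence (fun y => dyCoeff r y • rotGen y) x = 0
  rw [h, hdivJ, hax, mul_zero, add_zero]

end Literature.Analysis.SteadySlabLiouville.PeriodicSlab

end Part8

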